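import Literature.Topology.FourManifolds.NeckCapping
import Literature.Topology.FourManifolds.RadialDiffeomorph
import Literature.Topology.FourManifolds.ConnectedSumSphereIdentity
import Literature.Topology.FourManifolds.ChartTransport
import HarnessLib

/-!
# A connected sum contains a neck whose capped sides are the summands

Converse of `Literature.Topology.FourManifolds.NeckCapData.isConnectedSum_capped`
(`NeckCapping.lean`: surgery along a neck with two sides presents the manifold as the connected
sum of the two capped sides). Here we start from a **connected sum** in the sense of
Kervaire–Milnor (`Literature.Topology.FourManifolds.IsConnectedSum`, `ConnectedSum.lean`: `P` is
an open gluing of `M ∖ {i₁ 0}` and `N ∖ {i₂ 0}` along `i₁ (t • u) ∼ i₂ ((1 - t) • u)`,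
`‖u‖ = 1`, `0 < t < 1`, for arbitrary smooth disc embeddings `i₁ : E ↪ M`, `i₂ : E ↪ N`) and
produce the neck and its two sides:

* `Literature.Topology.FourManifolds.exists_neck_of_isConnectedSum` (**main result**): if the
  Hausdorff `C^∞` manifold `P`, modelled on a real inner product space `E` of dimension `n + 1`,
  is a connected sum `M # N` of Hausdorff `C^∞` manifolds, then there are a neck
  `ψ : Sⁿ × ℝ ↪ P` and sides `D₁ : NeckCapData n ψ`, `D₂ : NeckCapData n ψ⁻` (of `ψ` and of the
  flipped neck `ψ⁻ (θ, t) = ψ (θ, -t)`), disjoint and covering `P` off the middle sphere, with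
  `N ≅ D₁.Capped` and `M ≅ D₂.Capped`.

This is the tube picture of the connected sum, "connected sum is the operation of joining two
manifolds by a tube" (Kosinski, *Differential Manifolds*, Ch. VI §1, p. 90, Prop. 1.3), read
backwards: cutting the tube of `M # N` along its middle sphere and rounding off the two ends
gives back `M` and `N` — the topological content of R. Hamilton's remark that his surgeries and
connected sums are mutually inverse (*Four-manifolds with positive isotropic curvature*, Comm.
Anal. Geom. 5 (1997), §1.1, p. 4). It is used in
`Literature/Geometry/Riemannian/HamiltonSurgeryProgrammeProofs.lean` to show that the class of
neck-surgery resolvable 4-manifolds (`Literature.Geometry.Riemannian.IsNeckSurgeryResolvable`)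
is closed under connected sums.

## Construction and proof

Unpack the connected sum into charts `Φ₁`, `Φ₂` of `M`, `N` onto `E` with `iₖ = Φₖ⁻¹`
(`exists_chart_of_isSmoothEmbedding`) and the open embeddings `jM`, `jN` of the punctured
summands (`KMNeckData`; `KMNeckData.swap` exchanges the summands, the relation being symmetric
under `t ↦ 1 - t`).

1. **Profiles** (§1–§3, pure real analysis, namespace `TubeProfile`). The *neck profile* `ρ = tubeProfile : ℝ → (0, 1)` is
   a smooth strictly increasing bijection with `ρ (-τ) = 1 - ρ τ`, `ρ τ = 1/2 + τ/128` near `0`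
   and `ρ τ = 1 - 4/τ = ballProfile τ` for `τ ≥ 18` (`ballProfile` is the profile of the tree's
   ball contraction `ℝⁿ ≅ B(0, 1)`, `RadialDiffeomorph.lean`). The *squeeze profile*
   `n = squeezeProfile := ballProfile ∘ ρ⁻¹` on `(1/2, 1)`, the identity on `[7/9, ∞)`, is a
   smooth strictly increasing bijection `(1/2, ∞) → (0, ∞)` with **`n (ρ τ) = ballProfile τ`**;
   the radial map `squeeze : t • u ↦ n t • u` is a diffeomorphism `E ∖ B̄(0, 1/2) ≅ E ∖ {0}`,
   the identity on `‖z‖ ≥ 7/9`, with `squeeze (ρ τ • u) = ballContraction (τ • u)`.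
2. **The neck** (§4) is the tube `ψ (θ, τ) = jN (i₂ (ρ τ • θ))`; by Kervaire–Milnor's relation
   and the symmetry of `ρ`, `ψ (θ, -τ) = jM (i₁ (ρ τ • θ))` (`KMNeckData.neck_neg`), so every
   statement about the second summand gives the one about the first by swapping. `ψ` is a
   smooth embedding with open range `jN (i₂ (B(0, 1) ∖ {0}))` (an explicit partial homeomorphism
   with smooth inverse, `isSmoothEmbedding_of_openPartialHomeomorph`). Its sides are
   `sideN = jN (N ∖ i₂(B̄(0, 1/2)))` and the swapped one; they are disjoint and, with the middle
   sphere `jN (i₂ (∂B(0, 1/2)))`, partition `P` (trichotomy `KMNeckData.jN_mem_cases` by the norm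
   in the disc), which gives the `NeckCapData` axioms (`KMNeckData.capN`, `KMNeckData.capM`).
3. **The capped side is the summand** (§4, `KMNeckData.nonempty_diffeomorph_capped`). The capped
   side is by construction the open gluing of the side and the disc `E` along the polar relation
   `ψ (θ, t) ∼ t • θ` (`t > 0`). We present `N` as an open gluing of the *same* pieces along the
   *same* relation: the side `≅ N ∖ i₂(B̄(0, 1/2))` (via `jN`) `≅ N ∖ {i₂ 0}` (the squeeze,
   transported along `Φ₂`: `KMNeckData.Sq`) `⊆ N`, and the disc `E ↪ N` by
   `i₂ ∘ ballContraction`; the identity `squeeze (ρ t • θ) = ballContraction (t • θ)` says exactly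
   that the two pieces meet along the polar relation (`KMNeckData.farMap_eq_capMap_iff`).
   Uniqueness of open gluings (`IsOpenGluing.nonempty_diffeomorph`, `GluingUniqueness.lean`,
   Kosinski VI §1) then gives `N ≅ D₁.Capped`. (A squeeze `X ∖ B̄ ≅ X ∖ pt` of the summand is
   unavoidable: capping collapses the middle sphere of the tube, a sphere of positive radius in
   the disc of `N`, to the centre of the cap. The profile `ρ` is designed so that one squeeze
   serves both summands; the tree's fixed puncture expansion `punctureExpansion` cannot, its
   profile not being compatible with the reflection `t ↦ 1 - t`.)

## References

* A. A. Kosinski, *Differential Manifolds*, Academic Press (1993), Ch. VI §1 (p. 90, Prop. 1.3,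
  proof of Thm. 1.1). [Kosinski1993]
* M. A. Kervaire, J. W. Milnor, *Groups of homotopy spheres: I*, Ann. of Math. (2) 77 (1963),
  504–537, §2. [KervaireMilnor1963]
* R. S. Hamilton, *Four-manifolds with positive isotropic curvature*, Comm. Anal. Geom. 5 (1997)
  1–92, §1.1 pp. 3–4. [Hamilton1997]
-/

open scoped Manifold ContDiff Topology
open Set Function Metric Module Filter

noncomputable section

namespace Literature.Topology.FourManifolds

namespace TubeProfile

/-! ### §1 The neck profile `ρ` -/

section Profile

open Real

/-- The cut-off `χ₁ τ = transitionCut (τ - 2)`: `0` for `τ ≤ 10`, `1` for `τ ≥ 18`. [folklore] -/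
def tubeCut (τ : ℝ) : ℝ := transitionCut (τ - 2)

/-- `χ₁ τ = 0` for `τ ≤ 10`. [folklore] -/
theorem tubeCut_of_le {τ : ℝ} (h : τ ≤ 10) : tubeCut τ = 0 := transitionCut_of_le (by linarith)

/-- `χ₁ τ = 1` for `τ ≥ 18`. [folklore] -/
theorem tubeCut_of_ge {τ : ℝ} (h : 18 ≤ τ) : tubeCut τ = 1 := transitionCut_of_ge (by linarith)

/-- `0 ≤ χ₁`. [folklore] -/
theorem tubeCut_nonneg (τ : ℝ) : 0 ≤ tubeCut τ := transitionCut_nonneg _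

/-- `χ₁ ≤ 1`. [folklore] -/
theorem tubeCut_le_one (τ : ℝ) : tubeCut τ ≤ 1 := transitionCut_le_one _

/-- `χ₁` is smooth. [folklore] -/
theorem contDiff_tubeCut : ContDiff ℝ ∞ tubeCut :=
  (contDiff_transitionCut (n := ⊤)).comp (contDiff_id.sub contDiff_const)

/-- The derivative of `χ₁`. [folklore] -/
theorem hasDerivAt_tubeCut (τ : ℝ) : HasDerivAt tubeCut (deriv transitionCut (τ - 2)) τ := by
  have h := ((differentiable_transitionCut (τ - 2)).hasDerivAt).comp τ ((hasDerivAt_id' τ).sub_const 2)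
  rw [mul_one] at h
  exact h

/-- `χ₁' ≥ 0`. [folklore] -/
theorem deriv_tubeCut_nonneg (τ : ℝ) : 0 ≤ deriv transitionCut (τ - 2) := deriv_transitionCut_nonneg _

/-- `χ₁' = 0` below the transition zone. [folklore] -/
theorem deriv_tubeCut_of_lt {τ : ℝ} (h : τ < 10) : deriv transitionCut (τ - 2) = 0 :=
  deriv_transitionCut_of_lt (by linarith)

/-- `χ₁' = 0` above the transition zone. [folklore] -/
theorem deriv_tubeCut_of_gt {τ : ℝ} (h : 18 < τ) : deriv transitionCut (τ - 2) = 0 :=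
  deriv_transitionCut_of_gt (by linarith)

/-- The **half profile** `M τ = (1 - χ₁ τ) τ / 128 + χ₁ τ (1/2 - 4/τ)`: `τ / 128` for `τ ≤ 10`,
`1/2 - 4/τ` for `τ ≥ 18`, strictly increasing. [folklore] -/
def halfProfile (τ : ℝ) : ℝ := (1 - tubeCut τ) * (τ / 128) + tubeCut τ * (1 / 2 - 4 / τ)

/-- `M τ = τ / 128` for `τ ≤ 10`. [folklore] -/
theorem halfProfile_of_le {τ : ℝ} (h : τ ≤ 10) : halfProfile τ = τ / 128 := by
  rw [halfProfile, tubeCut_of_le h]; ring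

/-- `M τ = 1/2 - 4/τ` for `τ ≥ 18`. [folklore] -/
theorem halfProfile_of_ge {τ : ℝ} (h : 18 ≤ τ) : halfProfile τ = 1 / 2 - 4 / τ := by
  rw [halfProfile, tubeCut_of_ge h]; ring

/-- `M 0 = 0`. [folklore] -/
theorem halfProfile_zero : halfProfile 0 = 0 := by
  rw [halfProfile_of_le (by norm_num)]; simp

/-- The derivative of the half profile. [folklore] -/
def halfProfileDeriv (τ : ℝ) : ℝ :=
  (1 - tubeCut τ) / 128 + tubeCut τ * (4 / τ ^ 2) +
    deriv transitionCut (τ - 2) * (1 / 2 - 4 / τ - τ / 128)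

/-- The derivative of `M` away from `0`. [folklore] -/
theorem hasDerivAt_halfProfile {τ : ℝ} (h : τ ≠ 0) :
    HasDerivAt halfProfile (halfProfileDeriv τ) τ := by
  have hc := hasDerivAt_tubeCut τ
  have h1 : HasDerivAt (fun τ : ℝ => τ / 128) (1 / 128) τ := by
    simpa using (hasDerivAt_id' τ).div_const 128
  have h2 : HasDerivAt (fun τ : ℝ => 1 / 2 - 4 / τ) (4 / τ ^ 2) τ := by
    have h3 := (hasDerivAt_const τ (1 / 2 : ℝ)).sub
      ((hasDerivAt_const τ (4 : ℝ)).div (hasDerivAt_id' τ) h)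
    refine h3.congr_deriv ?_
    field_simp
    ring
  have h4 := (((hasDerivAt_const τ (1 : ℝ)).sub hc).mul h1).add (hc.mul h2)
  refine h4.congr_deriv ?_
  simp only [halfProfileDeriv, Pi.sub_apply]
  ring

/-- `M' = 1/128` below the transition zone. [folklore] -/
theorem halfProfileDeriv_of_lt {τ : ℝ} (h : τ < 10) : halfProfileDeriv τ = 1 / 128 := by
  rw [halfProfileDeriv, tubeCut_of_le h.le, deriv_tubeCut_of_lt h]; ring

/-- The derivative of `M` below the transition zone. [folklore] -/
theorem hasDerivAt_halfProfile_of_lt {τ : ℝ} (h : τ < 10) : HasDerivAt halfProfile (1 / 128) τ := by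
  have hev : halfProfile =ᶠ[𝓝 τ] fun τ => τ / 128 :=
    eventuallyEq_of_mem (Iio_mem_nhds h) fun x hx => halfProfile_of_le (le_of_lt hx)
  have h1 : HasDerivAt (fun τ : ℝ => τ / 128) (1 / 128) τ := by
    simpa using (hasDerivAt_id' τ).div_const 128
  exact h1.congr_of_eventuallyEq hev

/-- The derivative of `M` everywhere. [folklore] -/
theorem hasDerivAt_halfProfile' (τ : ℝ) : HasDerivAt halfProfile (halfProfileDeriv τ) τ := by
  rcases lt_or_ge τ 10 with h | h
  · rw [halfProfileDeriv_of_lt h]; exact hasDerivAt_halfProfile_of_lt h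
  · exact hasDerivAt_halfProfile (by linarith)

/-- `M` is smooth away from `0`. [folklore] -/
theorem contDiffAt_halfProfile_of_ne {τ : ℝ} (h : τ ≠ 0) : ContDiffAt ℝ ∞ halfProfile τ := by
  have h1 : ContDiffAt ℝ ∞ (fun τ : ℝ => 1 / 2 - 4 / τ) τ :=
    contDiffAt_const.sub (contDiffAt_const.div contDiffAt_id h)
  have hc : ContDiffAt ℝ ∞ tubeCut τ := contDiff_tubeCut.contDiffAt
  show ContDiffAt ℝ ∞ (fun τ => (1 - tubeCut τ) * (τ / 128) + tubeCut τ * (1 / 2 - 4 / τ)) τ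
  exact ((contDiffAt_const.sub hc).mul (contDiffAt_id.div_const _)).add (hc.mul h1)

/-- `M` is smooth. [folklore] -/
theorem contDiff_halfProfile : ContDiff ℝ ∞ halfProfile := by
  refine contDiff_iff_contDiffAt.2 fun τ => ?_
  rcases lt_or_ge τ 10 with h | h
  · have hev : halfProfile =ᶠ[𝓝 τ] fun τ => τ / 128 :=
      eventuallyEq_of_mem (Iio_mem_nhds h) fun x hx => halfProfile_of_le (le_of_lt hx)
    exact (contDiffAt_id.div_const (128 : ℝ)).congr_of_eventuallyEq hev
  · exact contDiffAt_halfProfile_of_ne (by linarith)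

/-- On the transition zone the target branch dominates the linear branch. [folklore] -/
theorem zone_nonneg {τ : ℝ} (h1 : 10 ≤ τ) (h2 : τ ≤ 18) : 0 ≤ 1 / 2 - 4 / τ - τ / 128 := by
  have hτ : 0 < τ := by linarith
  rw [show 1 / 2 - 4 / τ - τ / 128 = (64 * τ - 512 - τ ^ 2) / (128 * τ) by field_simp; ring]
  refine div_nonneg ?_ (by positivity)
  nlinarith [mul_nonneg (sub_nonneg.2 h1) (sub_nonneg.2 h2)]

/-- `M' > 0`. [folklore] -/
theorem halfProfileDeriv_pos (τ : ℝ) : 0 < halfProfileDeriv τ := by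
  rcases lt_or_ge τ 10 with h | h
  · rw [halfProfileDeriv_of_lt h]; norm_num
  have hτ : 0 < τ := by linarith
  have hc0 := tubeCut_nonneg τ
  have hc1 := tubeCut_le_one τ
  have hd := deriv_tubeCut_nonneg τ
  have hkey : 0 ≤ deriv transitionCut (τ - 2) * (1 / 2 - 4 / τ - τ / 128) := by
    rcases le_or_gt τ 18 with h18 | h18
    · exact mul_nonneg hd (zone_nonneg h h18)
    · rw [deriv_tubeCut_of_gt h18, zero_mul]
  have h4 : 0 < 4 / τ ^ 2 := by positivity
  have hmain : 0 < (1 - tubeCut τ) / 128 + tubeCut τ * (4 / τ ^ 2) := by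
    rcases hc1.lt_or_eq with hlt | heq
    · have : 0 < (1 - tubeCut τ) / 128 := div_pos (by linarith) (by norm_num)
      nlinarith [mul_nonneg hc0 h4.le]
    · rw [heq]; linarith
  unfold halfProfileDeriv
  linarith

/-- `0 < deriv M`. [folklore] -/
theorem deriv_halfProfile_pos (τ : ℝ) : 0 < deriv halfProfile τ := by
  rw [(hasDerivAt_halfProfile' τ).deriv]; exact halfProfileDeriv_pos τ

/-- `M` is strictly increasing. [folklore] -/
theorem strictMono_halfProfile : StrictMono halfProfile :=
  strictMono_of_deriv_pos deriv_halfProfile_pos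

/-- `0 ≤ M τ` for `τ ≥ 0`. [folklore] -/
theorem halfProfile_nonneg {τ : ℝ} (h : 0 ≤ τ) : 0 ≤ halfProfile τ := by
  rw [← halfProfile_zero]; exact strictMono_halfProfile.monotone h

/-- `M τ < 1/2` for all `τ`. [folklore] -/
theorem halfProfile_lt_half (τ : ℝ) : halfProfile τ < 1 / 2 := by
  rcases le_or_gt 18 τ with h | h
  · rw [halfProfile_of_ge h]
    have : 0 < 4 / τ := div_pos (by norm_num) (by linarith)
    linarith
  · calc halfProfile τ < halfProfile 18 := strictMono_halfProfile h
      _ = 1 / 2 - 4 / 18 := halfProfile_of_ge le_rfl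
      _ < 1 / 2 := by norm_num

/-- The **neck profile** `ρ τ = 1/2 ± M (±τ)`: the odd extension of `M` about `(0, 1/2)`.
A smooth strictly increasing bijection `ℝ → (0, 1)` with `ρ (-τ) = 1 - ρ τ`,
`ρ τ = 1/2 + τ/128` for `|τ| ≤ 10` and `ρ τ = 1 - 4/τ = ballProfile τ` for `τ ≥ 18`.
[folklore] -/
def tubeProfile (τ : ℝ) : ℝ := if 0 ≤ τ then 1 / 2 + halfProfile τ else 1 / 2 - halfProfile (-τ)

/-- `ρ τ = 1/2 + M τ` for `τ ≥ 0`. [folklore] -/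
theorem tubeProfile_of_nonneg {τ : ℝ} (h : 0 ≤ τ) : tubeProfile τ = 1 / 2 + halfProfile τ :=
  if_pos h

/-- `ρ τ = 1/2 - M (-τ)` for `τ ≤ 0`. [folklore] -/
theorem tubeProfile_of_nonpos {τ : ℝ} (h : τ ≤ 0) : tubeProfile τ = 1 / 2 - halfProfile (-τ) := by
  rcases h.lt_or_eq with h' | rfl
  · exact if_neg (not_le.2 h')
  · simp [tubeProfile, halfProfile_zero]

/-- **Symmetry** `ρ (-τ) = 1 - ρ τ`. [folklore] -/
theorem tubeProfile_neg (τ : ℝ) : tubeProfile (-τ) = 1 - tubeProfile τ := by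
  rcases le_total 0 τ with h | h
  · rw [tubeProfile_of_nonpos (neg_nonpos.2 h), neg_neg, tubeProfile_of_nonneg h]; ring
  · rw [tubeProfile_of_nonneg (neg_nonneg.2 h), tubeProfile_of_nonpos h]; ring

/-- `ρ 0 = 1/2`. [folklore] -/
theorem tubeProfile_zero : tubeProfile 0 = 1 / 2 := by
  rw [tubeProfile_of_nonneg le_rfl, halfProfile_zero, add_zero]

/-- `ρ τ = 1/2 + τ/128` for `|τ| ≤ 10`. [folklore] -/
theorem tubeProfile_of_abs_le {τ : ℝ} (h : |τ| ≤ 10) : tubeProfile τ = 1 / 2 + τ / 128 := by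
  rcases le_total 0 τ with h0 | h0
  · rw [tubeProfile_of_nonneg h0, halfProfile_of_le ((le_abs_self τ).trans h)]
  · rw [tubeProfile_of_nonpos h0, halfProfile_of_le ((neg_le_abs τ).trans h)]; ring

/-- `ρ τ = 1 - 4/τ` for `τ ≥ 18`. [folklore] -/
theorem tubeProfile_of_ge {τ : ℝ} (h : 18 ≤ τ) : tubeProfile τ = 1 - 4 / τ := by
  rw [tubeProfile_of_nonneg (by linarith), halfProfile_of_ge h]; ring

/-- `ρ τ = ballProfile τ` for `τ ≥ 18`. [folklore] -/
theorem tubeProfile_eq_ballProfile {τ : ℝ} (h : 18 ≤ τ) : tubeProfile τ = ballProfile τ := by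
  rw [tubeProfile_of_ge h, ballProfile_of_ge (by linarith)]

/-- `ρ τ = -4/τ` for `τ ≤ -18`. [folklore] -/
theorem tubeProfile_of_le_neg {τ : ℝ} (h : τ ≤ -18) : tubeProfile τ = -4 / τ := by
  have := tubeProfile_neg (-τ)
  rw [neg_neg, tubeProfile_of_ge (τ := -τ) (by linarith)] at this
  rw [this, div_neg]; ring

/-- The derivative of `ρ` is `M' |τ|`. [folklore] -/
theorem hasDerivAt_tubeProfile (τ : ℝ) : HasDerivAt tubeProfile (halfProfileDeriv |τ|) τ := by
  rcases lt_trichotomy τ 0 with h | rfl | h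
  · have hev : tubeProfile =ᶠ[𝓝 τ] fun x => 1 / 2 - halfProfile (-x) :=
      eventuallyEq_of_mem (Iio_mem_nhds h) fun x hx => tubeProfile_of_nonpos (le_of_lt hx)
    have h1 : HasDerivAt (fun x => halfProfile (-x)) (halfProfileDeriv (-τ) * -1) τ :=
      (hasDerivAt_halfProfile' (-τ)).comp τ (hasDerivAt_neg τ)
    have h2 := ((hasDerivAt_const τ (1 / 2 : ℝ)).sub h1).congr_of_eventuallyEq hev
    rw [abs_of_neg h]
    refine h2.congr_deriv ?_
    ring
  · have hev : tubeProfile =ᶠ[𝓝 0] fun x => 1 / 2 + x / 128 :=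
      eventuallyEq_of_mem (Ioo_mem_nhds (by norm_num : (-10 : ℝ) < 0) (by norm_num : (0 : ℝ) < 10))
        fun x hx => tubeProfile_of_abs_le (abs_le.2 ⟨hx.1.le, hx.2.le⟩)
    have h1 : HasDerivAt (fun x : ℝ => 1 / 2 + x / 128) (1 / 128) 0 := by
      simpa using ((hasDerivAt_id' (0 : ℝ)).div_const 128).const_add (1 / 2)
    rw [abs_zero, halfProfileDeriv_of_lt (by norm_num)]
    exact h1.congr_of_eventuallyEq hev
  · have hev : tubeProfile =ᶠ[𝓝 τ] fun x => 1 / 2 + halfProfile x :=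
      eventuallyEq_of_mem (Ioi_mem_nhds h) fun x hx => tubeProfile_of_nonneg (le_of_lt hx)
    rw [abs_of_pos h]
    exact ((hasDerivAt_halfProfile' τ).const_add (1 / 2)).congr_of_eventuallyEq hev

/-- `ρ` is smooth. [folklore] -/
theorem contDiff_tubeProfile : ContDiff ℝ ∞ tubeProfile := by
  refine contDiff_iff_contDiffAt.2 fun τ => ?_
  rcases lt_trichotomy τ 0 with h | rfl | h
  · have hev : tubeProfile =ᶠ[𝓝 τ] fun x => 1 / 2 - halfProfile (-x) :=
      eventuallyEq_of_mem (Iio_mem_nhds h) fun x hx => tubeProfile_of_nonpos (le_of_lt hx)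
    exact (contDiffAt_const.sub ((contDiff_halfProfile.comp contDiff_neg).contDiffAt)).congr_of_eventuallyEq hev
  · have hev : tubeProfile =ᶠ[𝓝 0] fun x => 1 / 2 + x / 128 :=
      eventuallyEq_of_mem (Ioo_mem_nhds (by norm_num : (-10 : ℝ) < 0) (by norm_num : (0 : ℝ) < 10))
        fun x hx => tubeProfile_of_abs_le (abs_le.2 ⟨hx.1.le, hx.2.le⟩)
    exact (contDiffAt_const.add (contDiffAt_id.div_const _)).congr_of_eventuallyEq hev
  · have hev : tubeProfile =ᶠ[𝓝 τ] fun x => 1 / 2 + halfProfile x :=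
      eventuallyEq_of_mem (Ioi_mem_nhds h) fun x hx => tubeProfile_of_nonneg (le_of_lt hx)
    exact (contDiffAt_const.add contDiff_halfProfile.contDiffAt).congr_of_eventuallyEq hev

/-- `ρ` is continuous. [folklore] -/
theorem continuous_tubeProfile : Continuous tubeProfile := contDiff_tubeProfile.continuous

/-- `0 < deriv ρ`. [folklore] -/
theorem deriv_tubeProfile_pos (τ : ℝ) : 0 < deriv tubeProfile τ := by
  rw [(hasDerivAt_tubeProfile τ).deriv]; exact halfProfileDeriv_pos _

/-- `ρ` is strictly increasing. [folklore] -/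
theorem strictMono_tubeProfile : StrictMono tubeProfile :=
  strictMono_of_deriv_pos deriv_tubeProfile_pos

/-- `ρ` is injective. [folklore] -/
theorem injective_tubeProfile : Injective tubeProfile := strictMono_tubeProfile.injective

/-- `0 < ρ τ < 1`. [folklore] -/
theorem tubeProfile_mem_Ioo (τ : ℝ) : tubeProfile τ ∈ Ioo (0 : ℝ) 1 := by
  have h18 : tubeProfile 18 = 7 / 9 := by rw [tubeProfile_of_ge le_rfl]; norm_num
  have h18' : tubeProfile (-18) = 2 / 9 := by rw [tubeProfile_of_le_neg le_rfl]; norm_num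
  rcases le_or_gt 18 τ with h | h
  · rw [tubeProfile_of_ge h]
    have h1 : 0 < 4 / τ := div_pos (by norm_num) (by linarith)
    have h2 : 4 / τ ≤ 4 / 18 := div_le_div_of_nonneg_left (by norm_num) (by norm_num) h
    constructor <;> linarith
  rcases le_or_gt τ (-18) with h' | h'
  · rw [tubeProfile_of_le_neg h']
    have hτ : 0 < -τ := by linarith
    have h1 : 0 < 4 / (-τ) := div_pos (by norm_num) hτ
    have h2 : 4 / (-τ) ≤ 4 / 18 := div_le_div_of_nonneg_left (by norm_num) (by norm_num) (by linarith)
    rw [show -4 / τ = 4 / (-τ) by rw [div_neg, neg_div]]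
    constructor <;> linarith
  · constructor
    · calc (0 : ℝ) < 2 / 9 := by norm_num
        _ = tubeProfile (-18) := h18'.symm
        _ < tubeProfile τ := strictMono_tubeProfile h'
    · calc tubeProfile τ < tubeProfile 18 := strictMono_tubeProfile h
        _ = 7 / 9 := h18
        _ < 1 := by norm_num

/-- `0 < ρ`. [folklore] -/
theorem tubeProfile_pos (τ : ℝ) : 0 < tubeProfile τ := (tubeProfile_mem_Ioo τ).1

/-- `ρ < 1`. [folklore] -/
theorem tubeProfile_lt_one (τ : ℝ) : tubeProfile τ < 1 := (tubeProfile_mem_Ioo τ).2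

/-- `1/2 < ρ τ ↔ 0 < τ`. [folklore] -/
theorem half_lt_tubeProfile_iff {τ : ℝ} : 1 / 2 < tubeProfile τ ↔ 0 < τ := by
  rw [← tubeProfile_zero]; exact strictMono_tubeProfile.lt_iff_lt

/-- `ρ τ ≤ 1/2 ↔ τ ≤ 0`. [folklore] -/
theorem tubeProfile_le_half_iff {τ : ℝ} : tubeProfile τ ≤ 1 / 2 ↔ τ ≤ 0 := by
  rw [← tubeProfile_zero]; exact strictMono_tubeProfile.le_iff_le

/-- `ρ 18 = 7/9`. [folklore] -/
theorem tubeProfile_eighteen : tubeProfile 18 = 7 / 9 := by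
  rw [tubeProfile_of_ge le_rfl]; norm_num

/-- **`ρ` maps onto `(0, 1)`.** [folklore] -/
theorem exists_tubeProfile_eq {s : ℝ} (hs : s ∈ Ioo (0 : ℝ) 1) : ∃ τ, tubeProfile τ = s := by
  set T : ℝ := max 18 (max (4 / (1 - s)) (4 / s)) with hT
  have hT18 : 18 ≤ T := le_max_left _ _
  have hTpos : 0 < T := by linarith
  have h1s : 0 < 1 - s := by linarith [hs.2]
  have hup : s ≤ tubeProfile T := by
    rw [tubeProfile_of_ge hT18]
    have h1 : 4 / (1 - s) ≤ T := (le_max_left _ _).trans (le_max_right _ _)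
    have h2 : 4 / T ≤ 1 - s := by
      rw [div_le_iff₀ hTpos]
      calc (4 : ℝ) = 4 / (1 - s) * (1 - s) := (div_mul_cancel₀ _ h1s.ne').symm
        _ ≤ T * (1 - s) := mul_le_mul_of_nonneg_right h1 h1s.le
        _ = (1 - s) * T := mul_comm _ _
    linarith
  have hdown : tubeProfile (-T) ≤ s := by
    rw [tubeProfile_of_le_neg (by linarith), show -4 / -T = 4 / T by rw [neg_div_neg_eq]]
    have h1 : 4 / s ≤ T := (le_max_right _ _).trans (le_max_right _ _)
    rw [div_le_iff₀ hTpos]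
    calc (4 : ℝ) = 4 / s * s := (div_mul_cancel₀ _ hs.1.ne').symm
      _ ≤ T * s := mul_le_mul_of_nonneg_right h1 hs.1.le
      _ = s * T := mul_comm _ _
  obtain ⟨τ, -, hτ⟩ := intermediate_value_Icc (by linarith : -T ≤ T)
    continuous_tubeProfile.continuousOn ⟨hdown, hup⟩
  exact ⟨τ, hτ⟩

/-- The inverse profile `ρ⁻¹` (a global left inverse of the injective `ρ`). [folklore] -/
def tubeProfileInv : ℝ → ℝ := invFun tubeProfile

/-- `ρ⁻¹ (ρ τ) = τ`. [folklore] -/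
theorem tubeProfileInv_tubeProfile (τ : ℝ) : tubeProfileInv (tubeProfile τ) = τ :=
  leftInverse_invFun injective_tubeProfile τ

/-- `ρ (ρ⁻¹ s) = s` for `s ∈ (0, 1)`. [folklore] -/
theorem tubeProfile_tubeProfileInv {s : ℝ} (hs : s ∈ Ioo (0 : ℝ) 1) :
    tubeProfile (tubeProfileInv s) = s := by
  obtain ⟨τ, rfl⟩ := exists_tubeProfile_eq hs
  rw [tubeProfileInv_tubeProfile]

/-- `ρ⁻¹` is smooth at `ρ τ` (inverse function theorem). [folklore] -/
theorem contDiffAt_tubeProfileInv (τ : ℝ) : ContDiffAt ℝ ∞ tubeProfileInv (tubeProfile τ) :=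
  contDiffAt_leftInverse_of_hasDerivAt contDiff_tubeProfile.contDiffAt (hasDerivAt_tubeProfile τ)
    (halfProfileDeriv_pos _).ne' (by simp) (leftInverse_invFun injective_tubeProfile)

/-- `ρ⁻¹` is smooth on `(0, 1)`. [folklore] -/
theorem contDiffAt_tubeProfileInv' {s : ℝ} (hs : s ∈ Ioo (0 : ℝ) 1) :
    ContDiffAt ℝ ∞ tubeProfileInv s := by
  obtain ⟨τ, rfl⟩ := exists_tubeProfile_eq hs
  exact contDiffAt_tubeProfileInv τ

/-- `0 < ρ⁻¹ s ↔ 1/2 < s` on `(0, 1)`. [folklore] -/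
theorem tubeProfileInv_pos_iff {s : ℝ} (hs : s ∈ Ioo (0 : ℝ) 1) : 0 < tubeProfileInv s ↔ 1 / 2 < s := by
  rw [← half_lt_tubeProfile_iff, tubeProfile_tubeProfileInv hs]

/-- `ρ⁻¹ s < 18 ↔ s < 7/9` on `(0, 1)`. [folklore] -/
theorem tubeProfileInv_lt_iff {s : ℝ} (hs : s ∈ Ioo (0 : ℝ) 1) : tubeProfileInv s < 18 ↔ s < 7 / 9 := by
  rw [← tubeProfile_eighteen, ← strictMono_tubeProfile.lt_iff_lt, tubeProfile_tubeProfileInv hs]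

/-- `ρ⁻¹` is strictly increasing on `(0, 1)`. [folklore] -/
theorem tubeProfileInv_lt_tubeProfileInv {s t : ℝ} (hs : s ∈ Ioo (0 : ℝ) 1) (ht : t ∈ Ioo (0 : ℝ) 1)
    (hst : s < t) : tubeProfileInv s < tubeProfileInv t := by
  rw [← strictMono_tubeProfile.lt_iff_lt, tubeProfile_tubeProfileInv hs, tubeProfile_tubeProfileInv ht]
  exact hst

/-! ### §2 The squeeze profile `n = ballProfile ∘ ρ⁻¹` -/

/-- `ballProfile 18 = 7/9`. [folklore] -/
theorem ballProfile_eighteen : ballProfile 18 = 7 / 9 := by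
  rw [ballProfile_of_ge (by norm_num)]; norm_num

/-- The **squeeze profile** `n s = ballProfile (ρ⁻¹ s)` for `s < 7/9` and `n s = s` for
`s ≥ 7/9`: a strictly increasing smooth bijection `(1/2, ∞) → (0, ∞)` with `n (ρ τ) = ballProfile τ`,
the identity on `[7/9, ∞)`. [folklore] -/
def squeezeProfile (s : ℝ) : ℝ := if s < 7 / 9 then ballProfile (tubeProfileInv s) else s

/-- `n s = s` for `s ≥ 7/9`. [folklore] -/
theorem squeezeProfile_of_ge {s : ℝ} (h : 7 / 9 ≤ s) : squeezeProfile s = s := if_neg (not_lt.2 h)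

/-- `n = ballProfile ∘ ρ⁻¹` on `(0, 1)`. [folklore] -/
theorem squeezeProfile_eq {s : ℝ} (hs : s ∈ Ioo (0 : ℝ) 1) :
    squeezeProfile s = ballProfile (tubeProfileInv s) := by
  by_cases h : s < 7 / 9
  · exact if_pos h
  · rw [squeezeProfile_of_ge (not_lt.1 h)]
    have h18 : 18 ≤ tubeProfileInv s := not_lt.1 fun h' => h ((tubeProfileInv_lt_iff hs).1 h')
    rw [← tubeProfile_eq_ballProfile h18, tubeProfile_tubeProfileInv hs]

/-- **The key identity** `n (ρ τ) = ballProfile τ`. [folklore] -/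
theorem squeezeProfile_tubeProfile (τ : ℝ) : squeezeProfile (tubeProfile τ) = ballProfile τ := by
  rw [squeezeProfile_eq (tubeProfile_mem_Ioo τ), tubeProfileInv_tubeProfile]

/-- `0 < n s` for `s > 1/2`. [folklore] -/
theorem squeezeProfile_pos {s : ℝ} (h : 1 / 2 < s) : 0 < squeezeProfile s := by
  rcases lt_or_ge s 1 with h1 | h1
  · have hs : s ∈ Ioo (0 : ℝ) 1 := ⟨by linarith, h1⟩
    rw [squeezeProfile_eq hs]
    exact ballProfile_pos ((tubeProfileInv_pos_iff hs).2 h)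
  · rw [squeezeProfile_of_ge (by linarith)]; linarith

/-- `n` is smooth on `(1/2, ∞)`. [folklore] -/
theorem contDiffAt_squeezeProfile {s : ℝ} (h : 1 / 2 < s) : ContDiffAt ℝ ∞ squeezeProfile s := by
  rcases lt_or_ge s 1 with h1 | h1
  · have hs : s ∈ Ioo (0 : ℝ) 1 := ⟨by linarith, h1⟩
    have hev : squeezeProfile =ᶠ[𝓝 s] fun s => ballProfile (tubeProfileInv s) :=
      eventuallyEq_of_mem (Ioo_mem_nhds hs.1 hs.2) fun x hx => squeezeProfile_eq hx
    refine (ContDiffAt.comp s (contDiffAt_ballProfile ?_) (contDiffAt_tubeProfileInv' hs)).congr_of_eventuallyEq hev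
    exact ((tubeProfileInv_pos_iff hs).2 h).ne'
  · have hev : squeezeProfile =ᶠ[𝓝 s] id :=
      eventuallyEq_of_mem (Ioi_mem_nhds (by linarith : (7 / 9 : ℝ) < s)) fun x hx =>
        squeezeProfile_of_ge (le_of_lt hx)
    exact contDiffAt_id.congr_of_eventuallyEq hev

/-- `n` is strictly increasing on `(1/2, ∞)`. [folklore] -/
theorem strictMonoOn_squeezeProfile : StrictMonoOn squeezeProfile (Ioi (1 / 2)) := by
  intro a ha b hb hab
  rw [mem_Ioi] at ha hb
  rcases lt_or_ge b (7 / 9) with hb' | hb'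
  · have haI : a ∈ Ioo (0 : ℝ) 1 := ⟨by linarith, by linarith⟩
    have hbI : b ∈ Ioo (0 : ℝ) 1 := ⟨by linarith, by linarith⟩
    rw [squeezeProfile_eq haI, squeezeProfile_eq hbI]
    exact strictMono_ballProfile (tubeProfileInv_lt_tubeProfileInv haI hbI hab)
  · rw [squeezeProfile_of_ge hb']
    rcases lt_or_ge a (7 / 9) with ha' | ha'
    · have haI : a ∈ Ioo (0 : ℝ) 1 := ⟨by linarith, by linarith⟩
      rw [squeezeProfile_eq haI]
      calc ballProfile (tubeProfileInv a) < ballProfile 18 :=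
            strictMono_ballProfile ((tubeProfileInv_lt_iff haI).2 ha')
        _ = 7 / 9 := ballProfile_eighteen
        _ ≤ b := hb'
    · rwa [squeezeProfile_of_ge ha']

/-- `n` is injective on `(1/2, ∞)`. [folklore] -/
theorem injOn_squeezeProfile : InjOn squeezeProfile (Ioi (1 / 2)) := strictMonoOn_squeezeProfile.injOn

/-- The **inverse squeeze profile** `n⁻¹ y = ρ (ballProfile⁻¹ y)` for `y < 7/9`, `n⁻¹ y = y`
for `y ≥ 7/9`. [folklore] -/
def squeezeProfileInv (y : ℝ) : ℝ := if y < 7 / 9 then tubeProfile (ballProfileInv y) else y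

/-- `n⁻¹ y = y` for `y ≥ 7/9`. [folklore] -/
theorem squeezeProfileInv_of_ge {y : ℝ} (h : 7 / 9 ≤ y) : squeezeProfileInv y = y := if_neg (not_lt.2 h)

/-- `n⁻¹ (ballProfile r) = ρ r` for `r > 0`. [folklore] -/
theorem squeezeProfileInv_ballProfile (r : ℝ) : squeezeProfileInv (ballProfile r) = tubeProfile r := by
  by_cases h : ballProfile r < 7 / 9
  · rw [squeezeProfileInv, if_pos h, ballProfileInv_ballProfile]
  · rw [squeezeProfileInv_of_ge (not_lt.1 h)]
    have h18 : 18 ≤ r := by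
      by_contra h'
      exact h (ballProfile_eighteen ▸ strictMono_ballProfile (not_le.1 h'))
    exact (tubeProfile_eq_ballProfile h18).symm

/-- `n⁻¹ = ρ ∘ ballProfile⁻¹` on `(0, 1)`. [folklore] -/
theorem squeezeProfileInv_eq {y : ℝ} (hy : y ∈ Ioo (0 : ℝ) 1) :
    squeezeProfileInv y = tubeProfile (ballProfileInv y) := by
  obtain ⟨r, hr, rfl⟩ := exists_ballProfile_eq hy
  rw [squeezeProfileInv_ballProfile, ballProfileInv_ballProfile]

/-- `n⁻¹ (n s) = s` for `s > 1/2`. [folklore] -/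
theorem squeezeProfileInv_squeezeProfile {s : ℝ} (h : 1 / 2 < s) :
    squeezeProfileInv (squeezeProfile s) = s := by
  rcases lt_or_ge s 1 with h1 | h1
  · have hs : s ∈ Ioo (0 : ℝ) 1 := ⟨by linarith, h1⟩
    rw [squeezeProfile_eq hs, squeezeProfileInv_ballProfile, tubeProfile_tubeProfileInv hs]
  · rw [squeezeProfile_of_ge (by linarith), squeezeProfileInv_of_ge (by linarith)]

/-- `n (n⁻¹ y) = y` for `y > 0`. [folklore] -/
theorem squeezeProfile_squeezeProfileInv {y : ℝ} (h : 0 < y) :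
    squeezeProfile (squeezeProfileInv y) = y := by
  rcases lt_or_ge y 1 with h1 | h1
  · obtain ⟨r, -, rfl⟩ := exists_ballProfile_eq ⟨h, h1⟩
    rw [squeezeProfileInv_ballProfile, squeezeProfile_tubeProfile]
  · rw [squeezeProfileInv_of_ge (by linarith), squeezeProfile_of_ge (by linarith)]

/-- `1/2 < n⁻¹ y` for `y > 0`. [folklore] -/
theorem half_lt_squeezeProfileInv {y : ℝ} (h : 0 < y) : 1 / 2 < squeezeProfileInv y := by
  rcases lt_or_ge y 1 with h1 | h1
  · obtain ⟨r, hr, rfl⟩ := exists_ballProfile_eq ⟨h, h1⟩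
    rw [squeezeProfileInv_ballProfile]
    exact half_lt_tubeProfile_iff.2 hr
  · rw [squeezeProfileInv_of_ge (by linarith)]; linarith

/-- `n⁻¹` is smooth on `(0, ∞)`. [folklore] -/
theorem contDiffAt_squeezeProfileInv {y : ℝ} (h : 0 < y) : ContDiffAt ℝ ∞ squeezeProfileInv y := by
  rcases lt_or_ge y 1 with h1 | h1
  · have hev : squeezeProfileInv =ᶠ[𝓝 y] fun y => tubeProfile (ballProfileInv y) :=
      eventuallyEq_of_mem (Ioo_mem_nhds h h1) fun z hz => squeezeProfileInv_eq hz
    obtain ⟨r, hr, rfl⟩ := exists_ballProfile_eq ⟨h, h1⟩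
    exact (contDiff_tubeProfile.contDiffAt.comp _ (contDiffAt_ballProfileInv hr)).congr_of_eventuallyEq hev
  · have hev : squeezeProfileInv =ᶠ[𝓝 y] id :=
      eventuallyEq_of_mem (Ioi_mem_nhds (by linarith : (7 / 9 : ℝ) < y)) fun x hx =>
        squeezeProfileInv_of_ge (le_of_lt hx)
    exact contDiffAt_id.congr_of_eventuallyEq hev

end Profile

/-! ### §3 The radial squeeze `E ∖ B̄(0, 1/2) ≅ E ∖ {0}` -/

section Squeeze

variable {E : Type*} [NormedAddCommGroup E] [InnerProductSpace ℝ E]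

/-- The **radial squeeze** `t • u ↦ n t • u`: a diffeomorphism of the exterior `‖z‖ > 1/2` of the
ball of radius `1/2` onto the punctured space, the identity on `‖z‖ ≥ 7/9`. [folklore] -/
def squeeze : E → E := radialMap squeezeProfile

/-- The inverse squeeze `t • u ↦ n⁻¹ t • u`. [folklore] -/
def squeezeInv : E → E := radialMap squeezeProfileInv

omit [InnerProductSpace ℝ E] in
/-- A vector of norm `> 1/2` is nonzero. [folklore] -/
theorem ne_zero_of_half_lt {z : E} (hz : 1 / 2 < ‖z‖) : z ≠ 0 := by
  rintro rfl; rw [norm_zero] at hz; linarith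

/-- `‖squeeze z‖ = n ‖z‖` for `‖z‖ > 1/2`. [folklore] -/
theorem norm_squeeze {z : E} (hz : 1 / 2 < ‖z‖) : ‖squeeze z‖ = squeezeProfile ‖z‖ := by
  rw [squeeze, norm_radialMap _ (ne_zero_of_half_lt hz), abs_of_pos (squeezeProfile_pos hz)]

/-- The squeeze misses the origin on `‖z‖ > 1/2`. [folklore] -/
theorem squeeze_ne_zero {z : E} (hz : 1 / 2 < ‖z‖) : squeeze z ≠ 0 :=
  norm_pos_iff.1 (by rw [norm_squeeze hz]; exact squeezeProfile_pos hz)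

/-- `‖squeezeInv y‖ = n⁻¹ ‖y‖` for `y ≠ 0`. [folklore] -/
theorem norm_squeezeInv {y : E} (hy : y ≠ 0) : ‖squeezeInv y‖ = squeezeProfileInv ‖y‖ := by
  rw [squeezeInv, norm_radialMap _ hy, abs_of_pos]
  linarith [half_lt_squeezeProfileInv (norm_pos_iff.2 hy)]

/-- The inverse squeeze lands in `‖z‖ > 1/2`. [folklore] -/
theorem half_lt_norm_squeezeInv {y : E} (hy : y ≠ 0) : 1 / 2 < ‖squeezeInv y‖ := by
  rw [norm_squeezeInv hy]; exact half_lt_squeezeProfileInv (norm_pos_iff.2 hy)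

/-- The squeeze is the identity on `‖z‖ ≥ 7/9`. [folklore] -/
theorem squeeze_eq_self {z : E} (h : 7 / 9 ≤ ‖z‖) : squeeze z = z :=
  radialMap_eq_self _ (squeezeProfile_of_ge h)

/-- The inverse squeeze is the identity on `‖y‖ ≥ 7/9`. [folklore] -/
theorem squeezeInv_eq_self {y : E} (h : 7 / 9 ≤ ‖y‖) : squeezeInv y = y :=
  radialMap_eq_self _ (squeezeProfileInv_of_ge h)

/-- `squeezeInv (squeeze z) = z` for `‖z‖ > 1/2`. [folklore] -/
theorem squeezeInv_squeeze {z : E} (hz : 1 / 2 < ‖z‖) : squeezeInv (squeeze z) = z := by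
  have hz0 := ne_zero_of_half_lt hz
  rw [squeezeInv, squeeze, radialMap_radialMap _ _ hz0 (squeezeProfile_pos hz),
    squeezeProfileInv_squeezeProfile hz, mul_inv_cancel₀ (norm_ne_zero_iff.2 hz0), one_smul]

/-- `squeeze (squeezeInv y) = y` for `y ≠ 0`. [folklore] -/
theorem squeeze_squeezeInv {y : E} (hy : y ≠ 0) : squeeze (squeezeInv y) = y := by
  have h1 : 0 < squeezeProfileInv ‖y‖ := by linarith [half_lt_squeezeProfileInv (norm_pos_iff.2 hy)]
  rw [squeezeInv, squeeze, radialMap_radialMap _ _ hy h1,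
    squeezeProfile_squeezeProfileInv (norm_pos_iff.2 hy), mul_inv_cancel₀ (norm_ne_zero_iff.2 hy),
    one_smul]

/-- `squeeze (t • u) = n t • u` for a unit vector `u` and `t > 0`. [folklore] -/
theorem squeeze_smul {u : E} (hu : ‖u‖ = 1) {t : ℝ} (ht : 0 < t) :
    squeeze (t • u) = squeezeProfile t • u := radialMap_smul _ hu ht

/-- **The squeeze straightens the neck profile into the ball contraction**:
`squeeze (ρ τ • u) = ballContraction (τ • u)` (`‖u‖ = 1`, `τ > 0`). [folklore] -/
theorem squeeze_tubeProfile_smul {u : E} (hu : ‖u‖ = 1) {τ : ℝ} (hτ : 0 < τ) :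
    squeeze (tubeProfile τ • u) = ballContraction (τ • u) := by
  rw [squeeze_smul hu (tubeProfile_pos τ), squeezeProfile_tubeProfile, ballContraction_smul hu hτ]

/-- The squeeze is smooth on `‖z‖ > 1/2`. [folklore] -/
theorem contDiffAt_squeeze {z : E} (hz : 1 / 2 < ‖z‖) : ContDiffAt ℝ ∞ squeeze z :=
  contDiffAt_radialMap (ne_zero_of_half_lt hz) (contDiffAt_squeezeProfile hz)

/-- The squeeze is smooth on the exterior of the ball of radius `1/2`. [folklore] -/
theorem contDiffOn_squeeze : ContDiffOn ℝ ∞ (squeeze : E → E) {z | 1 / 2 < ‖z‖} := fun _ hz =>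
  (contDiffAt_squeeze hz).contDiffWithinAt

/-- The inverse squeeze is smooth off the origin. [folklore] -/
theorem contDiffAt_squeezeInv {y : E} (hy : y ≠ 0) : ContDiffAt ℝ ∞ squeezeInv y :=
  contDiffAt_radialMap hy (contDiffAt_squeezeProfileInv (norm_pos_iff.2 hy))

/-- The inverse squeeze is smooth on `E ∖ {0}`. [folklore] -/
theorem contDiffOn_squeezeInv : ContDiffOn ℝ ∞ (squeezeInv : E → E) {0}ᶜ := fun _ hy =>
  (contDiffAt_squeezeInv hy).contDiffWithinAt

omit [InnerProductSpace ℝ E] in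
/-- `{‖z‖ > 1/2}` is open. [folklore] -/
theorem isOpen_half_lt_norm : IsOpen {z : E | 1 / 2 < ‖z‖} :=
  isOpen_lt continuous_const continuous_norm

end Squeeze

end TubeProfile

open TubeProfile

/-! ### §4 Kervaire–Milnor gluing data and the neck of a connected sum -/

section KM

universe uM uN uP v

variable {E : Type v} [NormedAddCommGroup E] [InnerProductSpace ℝ E]
  {M : Type uM} [TopologicalSpace M] [T2Space M] [ChartedSpace E M]
  {N : Type uN} [TopologicalSpace N] [T2Space N] [ChartedSpace E N]
  {P : Type uP} [TopologicalSpace P] [ChartedSpace E P]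

variable (E M N P) in
/-- **Kervaire–Milnor gluing data in chart form.** Charts `Φ₁`, `Φ₂` of `M`, `N` onto the whole
model space `E` (so that the discs of the connected sum are `i₁ = Φ₁⁻¹`, `i₂ = Φ₂⁻¹ : E ↪ M, N`,
cf. `exists_chart_of_isSmoothEmbedding`), and open smooth embeddings `jM : M ∖ {i₁ 0} → P`,
`jN : N ∖ {i₂ 0} → P` covering `P` and meeting exactly along Kervaire–Milnor's relation
`i₁ (t • u) ∼ i₂ ((1 - t) • u)` (`‖u‖ = 1`, `0 < t < 1`) — an unpacked witness of
`IsConnectedSum 𝓘(ℝ, E) 𝓘(ℝ, E) 𝓘(ℝ, E) M N P` (Kervaire–Milnor 1963, §2; Kosinski VI §1).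
Compared with the purely topological unpacking `ConnectedSumNeck` of `HomotopySpheresSum.lean`
(continuous discs, topological embeddings), the discs are recorded as smooth charts onto `E`,
which is what the transport of the radial squeeze along `Φ₂` needs.
The parameter `n` (`dim E = n + 1`) fixes the manifold structure of the unit sphere `Sⁿ ⊆ E`
carrying the neck. [cite: KervaireMilnor1963, §2] -/
structure KMNeckData (n : ℕ) [Fact (finrank ℝ E = n + 1)] where
  /-- a chart of `M` onto `E`; the first disc is `Φ₁.symm` -/
  Φ₁ : OpenPartialHomeomorph M E
  /-- the chart is onto `E` -/
  target₁ : Φ₁.target = univ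
  /-- the chart is smooth on its source -/
  contMDiffOn_Φ₁ : ContMDiffOn 𝓘(ℝ, E) 𝓘(ℝ, E) ∞ Φ₁ Φ₁.source
  /-- the first disc is smooth -/
  contMDiff_symm₁ : ContMDiff 𝓘(ℝ, E) 𝓘(ℝ, E) ∞ Φ₁.symm
  /-- a chart of `N` onto `E`; the second disc is `Φ₂.symm` -/
  Φ₂ : OpenPartialHomeomorph N E
  /-- the chart is onto `E` -/
  target₂ : Φ₂.target = univ
  /-- the chart is smooth on its source -/
  contMDiffOn_Φ₂ : ContMDiffOn 𝓘(ℝ, E) 𝓘(ℝ, E) ∞ Φ₂ Φ₂.source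
  /-- the second disc is smooth -/
  contMDiff_symm₂ : ContMDiff 𝓘(ℝ, E) 𝓘(ℝ, E) ∞ Φ₂.symm
  /-- the embedding of the punctured first summand -/
  jM : ↥(puncture (Φ₁.symm : E → M)) → P
  /-- the embedding of the punctured second summand -/
  jN : ↥(puncture (Φ₂.symm : E → N)) → P
  /-- `jM` is a smooth embedding -/
  isSmoothEmbedding_jM : Manifold.IsSmoothEmbedding 𝓘(ℝ, E) 𝓘(ℝ, E) ∞ jM
  /-- `jM` has open range -/
  isOpen_range_jM : IsOpen (range jM)
  /-- `jN` is a smooth embedding -/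
  isSmoothEmbedding_jN : Manifold.IsSmoothEmbedding 𝓘(ℝ, E) 𝓘(ℝ, E) ∞ jN
  /-- `jN` has open range -/
  isOpen_range_jN : IsOpen (range jN)
  /-- the two punctured summands cover `P` -/
  cover : range jM ∪ range jN = univ
  /-- they meet exactly along Kervaire–Milnor's relation -/
  rel : ∀ a b, jM a = jN b ↔ connectedSumRel (Φ₁.symm : E → M) (Φ₂.symm : E → N) a b

namespace KMNeckData

variable {n : ℕ} [Fact (finrank ℝ E = n + 1)] (D : KMNeckData E M N P n)

/-! #### The discs and the swap -/

/-- The first disc `i₁ = Φ₁⁻¹ : E → M`. [folklore] -/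
abbrev i₁ : E → M := D.Φ₁.symm

/-- The second disc `i₂ = Φ₂⁻¹ : E → N`. [folklore] -/
abbrev i₂ : E → N := D.Φ₂.symm

/-- **The swapped data**: exchange the roles of the two summands (the relation is symmetric under
`t ↦ 1 - t`, `connectedSumRel_swap`). [cite: KervaireMilnor1963, §2] -/
def swap : KMNeckData E N M P n where
  Φ₁ := D.Φ₂
  target₁ := D.target₂
  contMDiffOn_Φ₁ := D.contMDiffOn_Φ₂
  contMDiff_symm₁ := D.contMDiff_symm₂
  Φ₂ := D.Φ₁
  target₂ := D.target₁
  contMDiffOn_Φ₂ := D.contMDiffOn_Φ₁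
  contMDiff_symm₂ := D.contMDiff_symm₁
  jM := D.jN
  jN := D.jM
  isSmoothEmbedding_jM := D.isSmoothEmbedding_jN
  isOpen_range_jM := D.isOpen_range_jN
  isSmoothEmbedding_jN := D.isSmoothEmbedding_jM
  isOpen_range_jN := D.isOpen_range_jM
  cover := by rw [union_comm]; exact D.cover
  rel b a := by
    have h := congrFun (congrFun (connectedSumRel_swap (D.Φ₁.symm : E → M) (D.Φ₂.symm : E → N)) b) a
    rw [← h, eq_comm]
    exact D.rel a b

/-- The swapped `jN` is `jM`. [folklore] -/
@[simp] theorem swap_jN : D.swap.jN = D.jM := rfl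

/-- The swapped `jM` is `jN`. [folklore] -/
@[simp] theorem swap_jM : D.swap.jM = D.jN := rfl

/-- The swapped second disc is the first disc. [folklore] -/
@[simp] theorem swap_i₂ : D.swap.i₂ = D.i₁ := rfl

/-- The swapped first disc is the second disc. [folklore] -/
@[simp] theorem swap_i₁ : D.swap.i₁ = D.i₂ := rfl

/-- The swapped second chart is the first chart. [folklore] -/
@[simp] theorem swap_Φ₂ : D.swap.Φ₂ = D.Φ₁ := rfl

/-- Swapping twice gives the data back. [folklore] -/
@[simp] theorem swap_swap : D.swap.swap = D := rfl

/-- `i₂ y ∈ Φ₂.source`. [folklore] -/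
theorem i₂_mem_source (y : E) : D.i₂ y ∈ D.Φ₂.source :=
  D.Φ₂.map_target (by rw [D.target₂]; exact mem_univ y)

/-- `Φ₂ (i₂ y) = y`. [folklore] -/
@[simp] theorem Φ₂_i₂ (y : E) : D.Φ₂ (D.i₂ y) = y :=
  D.Φ₂.right_inv (by rw [D.target₂]; exact mem_univ y)

/-- `i₂ (Φ₂ x) = x` on the source. [folklore] -/
theorem i₂_Φ₂ {x : N} (hx : x ∈ D.Φ₂.source) : D.i₂ (D.Φ₂ x) = x := D.Φ₂.left_inv hx

/-- `i₂` is injective. [folklore] -/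
theorem injective_i₂ : Injective D.i₂ := fun y y' h => by rw [← D.Φ₂_i₂ y, ← D.Φ₂_i₂ y', h]

/-- `Φ₂.source = range i₂`. [folklore] -/
theorem source₂_eq : D.Φ₂.source = range D.i₂ := by
  rw [← D.Φ₂.symm_image_target_eq_source, D.target₂, image_univ]

/-- `i₂` is smooth. [folklore] -/
theorem contMDiff_i₂ : ContMDiff 𝓘(ℝ, E) 𝓘(ℝ, E) ∞ D.i₂ := D.contMDiff_symm₂

/-- `i₂` is continuous. [folklore] -/
theorem continuous_i₂ : Continuous D.i₂ := D.contMDiff_i₂.continuous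

/-- `i₂` maps open sets to open sets. [folklore] -/
theorem isOpen_image_i₂ {s : Set E} (hs : IsOpen s) : IsOpen (D.i₂ '' s) :=
  D.Φ₂.symm.isOpen_image_of_subset_source hs (by rw [D.Φ₂.symm_source, D.target₂]; exact subset_univ _)

/-- The image of a closed ball under `i₂` is closed. [folklore] -/
theorem isClosed_image_i₂_closedBall (r : ℝ) : IsClosed (D.i₂ '' closedBall 0 r) := by
  haveI : FiniteDimensional ℝ E := .of_fact_finrank_eq_succ (K := ℝ) (V := E) n
  exact ((isCompact_closedBall _ _).image D.continuous_i₂).isClosed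

/-- A point `i₂ y` of the punctured summand has `y ≠ 0`. [folklore] -/
theorem ne_zero_of_mem_puncture {y : E} (h : D.i₂ y ∈ puncture D.i₂) : y ≠ 0 := fun hy =>
  (mem_puncture.1 h) (by rw [hy])

/-- `i₂ y` lies in the punctured summand for `y ≠ 0`. [folklore] -/
theorem i₂_mem_puncture {y : E} (hy : y ≠ 0) : D.i₂ y ∈ puncture D.i₂ :=
  mem_puncture.2 fun h => hy (D.injective_i₂ h)

/-- **Kervaire–Milnor's identification** `jM (i₁ (t • u)) = jN (i₂ ((1 - t) • u))`. [cite: KervaireMilnor1963, §2] -/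
theorem jM_eq_jN {u : E} (hu : ‖u‖ = 1) {t : ℝ} (ht : t ∈ Ioo (0 : ℝ) 1)
    (ha : D.i₁ (t • u) ∈ puncture D.i₁) (hb : D.i₂ ((1 - t) • u) ∈ puncture D.i₂) :
    D.jM ⟨D.i₁ (t • u), ha⟩ = D.jN ⟨D.i₂ ((1 - t) • u), hb⟩ :=
  (D.rel _ _).2 ⟨u, t, hu, ht, rfl, rfl⟩

/-- The punctured second summand is nonempty. [folklore] -/
instance nonempty_puncture : Nonempty ↥(puncture D.i₂) :=
  let θ : sphere (0 : E) 1 := unitSpherePoint n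
  ⟨⟨D.i₂ (θ : E), D.i₂_mem_puncture (ne_zero_of_mem_unit_sphere θ)⟩⟩

/-- `jN` is an open embedding. [folklore] -/
theorem isOpenEmbedding_jN : Topology.IsOpenEmbedding D.jN :=
  ⟨D.isSmoothEmbedding_jN.isEmbedding, D.isOpen_range_jN⟩

/-- `jN` is injective. [folklore] -/
theorem injective_jN : Injective D.jN := D.isSmoothEmbedding_jN.isEmbedding.injective

/-- `jN` as an open partial homeomorphism onto its range. [folklore] -/
def jNH : OpenPartialHomeomorph ↥(puncture D.i₂) P := D.isOpenEmbedding_jN.toOpenPartialHomeomorph D.jN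

/-- `jN⁻¹ (jN b) = b`. [folklore] -/
@[simp] theorem jNH_symm_jN (b : ↥(puncture D.i₂)) : D.jNH.symm (D.jN b) = b :=
  D.isOpenEmbedding_jN.toOpenPartialHomeomorph_left_inv

/-- `jN (jN⁻¹ p) = p` on the range of `jN`. [folklore] -/
theorem jN_jNH_symm {p : P} (hp : p ∈ range D.jN) : D.jN (D.jNH.symm p) = p :=
  Topology.IsOpenEmbedding.toOpenPartialHomeomorph_right_inv D.jN D.isOpenEmbedding_jN hp

/-- `jN⁻¹` is smooth on the range of `jN`. [folklore] -/
theorem contMDiffOn_jNH_symm : ContMDiffOn 𝓘(ℝ, E) 𝓘(ℝ, E) ∞ D.jNH.symm (range D.jN) :=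
  contMDiffOn_symm_of_isSmoothEmbedding D.isSmoothEmbedding_jN D.isOpenEmbedding_jN

/-! #### The neck -/

/-- `i₂ (ρ τ • θ)` lies in the punctured summand. [folklore] -/
theorem i₂_smul_mem (θ : sphere (0 : E) 1) (τ : ℝ) :
    D.i₂ (tubeProfile τ • (θ : E)) ∈ puncture D.i₂ :=
  D.i₂_mem_puncture (smul_ne_zero (tubeProfile_pos τ).ne' (ne_zero_of_mem_unit_sphere θ))

/-- **The neck of the connected sum**: `ψ (θ, τ) = jN (i₂ (ρ τ • θ))`, the radial tube of the
second disc reparametrised by the neck profile `ρ : ℝ ≅ (0, 1)`; by Kervaire–Milnor's relation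
and `ρ (-τ) = 1 - ρ τ`, the flipped neck `ψ (θ, -τ)` is the same tube read in the first disc,
`jM (i₁ (ρ τ • θ))` (`neck_neg`). [cite: Kosinski1993, Ch. VI §1 (p. 90; Prop. 1.3)] -/
def neck (q : sphere (0 : E) 1 × ℝ) : P :=
  D.jN ⟨D.i₂ (tubeProfile q.2 • (q.1 : E)), D.i₂_smul_mem q.1 q.2⟩

/-- Unfolding the neck. [folklore] -/
theorem neck_apply (θ : sphere (0 : E) 1) (τ : ℝ) :
    D.neck (θ, τ) = D.jN ⟨D.i₂ (tubeProfile τ • (θ : E)), D.i₂_smul_mem θ τ⟩ := rfl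

/-- **The flipped neck is the neck of the swapped data**: `ψ (θ, -τ) = jM (i₁ (ρ τ • θ))`. [cite: KervaireMilnor1963, §2] -/
theorem neck_neg (θ : sphere (0 : E) 1) (τ : ℝ) : D.neck (θ, -τ) = D.swap.neck (θ, τ) := by
  show D.jN ⟨D.i₂ (tubeProfile (-τ) • (θ : E)), _⟩ = D.jM ⟨D.i₁ (tubeProfile τ • (θ : E)), _⟩
  rw [eq_comm, D.rel]
  refine ⟨θ, tubeProfile τ, norm_eq_of_mem_sphere θ, tubeProfile_mem_Ioo τ, rfl, ?_⟩
  show D.i₂ (tubeProfile (-τ) • (θ : E)) = D.i₂ ((1 - tubeProfile τ) • (θ : E))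
  rw [tubeProfile_neg]

/-- The flipped neck, as a function, is the neck of the swapped data. [folklore] -/
theorem neck_flip_eq : (fun q : sphere (0 : E) 1 × ℝ => D.neck (q.1, -q.2)) = D.swap.neck := by
  funext q; exact D.neck_neg q.1 q.2

/-- The inverse of the neck: `p ↦ (w / ‖w‖, ρ⁻¹ ‖w‖)` with `w = Φ₂ (jN⁻¹ p)`. [folklore] -/
def neckInv (p : P) : sphere (0 : E) 1 × ℝ :=
  (unitDir (unitSpherePoint n) (D.Φ₂ ((D.jNH.symm p : ↥(puncture D.i₂)) : N)),
    tubeProfileInv ‖D.Φ₂ ((D.jNH.symm p : ↥(puncture D.i₂)) : N)‖)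

/-- `‖ρ τ • θ‖ = ρ τ`. [folklore] -/
theorem norm_tubeProfile_smul (θ : sphere (0 : E) 1) (τ : ℝ) :
    ‖tubeProfile τ • (θ : E)‖ = tubeProfile τ := by
  rw [norm_smul, norm_eq_of_mem_sphere, mul_one, Real.norm_of_nonneg (tubeProfile_pos τ).le]

/-- `neckInv (neck q) = q`. [folklore] -/
theorem neckInv_neck (q : sphere (0 : E) 1 × ℝ) : D.neckInv (D.neck q) = q := by
  obtain ⟨θ, τ⟩ := q
  simp only [neckInv, neck_apply, jNH_symm_jN, Φ₂_i₂]
  rw [unitDir_smul _ θ (tubeProfile_pos τ), norm_tubeProfile_smul, tubeProfileInv_tubeProfile]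

/-- The neck is injective. [folklore] -/
theorem injective_neck : Injective D.neck := fun q q' h => by
  rw [← D.neckInv_neck q, ← D.neckInv_neck q', h]

/-- **The range of the neck** is the image of the punctured open unit disc `i₂ (B(0, 1) ∖ {0})`.
[folklore] -/
theorem range_neck : range D.neck =
    D.jN '' {b | (b : N) ∈ D.i₂ '' ({0}ᶜ ∩ ball 0 1)} := by
  apply Subset.antisymm
  · rintro _ ⟨⟨θ, τ⟩, rfl⟩
    refine ⟨_, ⟨tubeProfile τ • (θ : E), ⟨?_, ?_⟩, rfl⟩, rfl⟩
    · exact smul_ne_zero (tubeProfile_pos τ).ne' (ne_zero_of_mem_unit_sphere θ)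
    · rw [mem_ball_zero_iff, norm_tubeProfile_smul]; exact tubeProfile_lt_one τ
  · rintro _ ⟨b, ⟨x, ⟨hx0, hx1⟩, hbx⟩, rfl⟩
    rw [mem_compl_iff, mem_singleton_iff] at hx0
    rw [mem_ball_zero_iff] at hx1
    have hxI : ‖x‖ ∈ Ioo (0 : ℝ) 1 := ⟨norm_pos_iff.2 hx0, hx1⟩
    refine ⟨(unitDir (unitSpherePoint n) x, tubeProfileInv ‖x‖), ?_⟩
    rw [neck_apply]
    congr 1
    apply Subtype.ext
    show D.i₂ (tubeProfile (tubeProfileInv ‖x‖) • (unitDir (unitSpherePoint n) x : E)) = b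
    rw [tubeProfile_tubeProfileInv hxI, norm_smul_coe_unitDir _ hx0, hbx]

/-- The range of the neck is open. [folklore] -/
theorem isOpen_range_neck : IsOpen (range D.neck) := by
  rw [range_neck]
  refine D.isOpenEmbedding_jN.isOpenMap _ ?_
  exact (D.isOpen_image_i₂ (isOpen_compl_singleton.inter isOpen_ball)).preimage continuous_subtype_val

/-- The range of the neck lies in the range of `jN`. [folklore] -/
theorem range_neck_subset : range D.neck ⊆ range D.jN := by
  rintro _ ⟨q, rfl⟩; exact ⟨_, rfl⟩

/-- The neck is smooth. [folklore] -/
theorem contMDiff_neck : ContMDiff ((𝓡 n).prod 𝓘(ℝ, ℝ)) 𝓘(ℝ, E) ∞ D.neck := by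
  have h1 : ContMDiff ((𝓡 n).prod 𝓘(ℝ, ℝ)) 𝓘(ℝ, E) ∞
      (fun q : sphere (0 : E) 1 × ℝ => D.i₂ (tubeProfile q.2 • (q.1 : E))) :=
    D.contMDiff_i₂.comp (((contMDiff_iff_contDiff.2 contDiff_tubeProfile).comp contMDiff_snd).smul
      (contMDiff_coe_sphere.comp contMDiff_fst))
  have h2 : ContMDiff ((𝓡 n).prod 𝓘(ℝ, ℝ)) 𝓘(ℝ, E) ∞
      (fun q : sphere (0 : E) 1 × ℝ => (⟨D.i₂ (tubeProfile q.2 • (q.1 : E)), D.i₂_smul_mem q.1 q.2⟩ :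
        ↥(puncture D.i₂))) :=
    (ContMDiff.subtypeVal_comp_iff _ _).1 h1
  exact D.isSmoothEmbedding_jN.contMDiff.comp h2

/-- The neck is continuous. [folklore] -/
theorem continuous_neck : Continuous D.neck := D.contMDiff_neck.continuous

/-- The inverse of the neck is smooth on the range of the neck. [folklore] -/
theorem contMDiffOn_neckInv : ContMDiffOn 𝓘(ℝ, E) ((𝓡 n).prod 𝓘(ℝ, ℝ)) ∞ D.neckInv (range D.neck) := by
  -- the model part `w ↦ (w / ‖w‖, ρ⁻¹ ‖w‖)` on the punctured unit ball
  have hF : ContMDiffOn 𝓘(ℝ, E) ((𝓡 n).prod 𝓘(ℝ, ℝ)) ∞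
      (fun w : E => (unitDir (unitSpherePoint n) w, tubeProfileInv ‖w‖)) ({0}ᶜ ∩ ball 0 1) := by
    refine ((contMDiffOn_unitDir (unitSpherePoint n)).mono inter_subset_left).prodMk ?_
    rw [contMDiffOn_iff_contDiffOn]
    rintro w ⟨hw0, hw1⟩
    rw [mem_compl_iff, mem_singleton_iff] at hw0
    rw [mem_ball_zero_iff] at hw1
    exact ((contDiffAt_tubeProfileInv' ⟨norm_pos_iff.2 hw0, hw1⟩).comp w
      (contDiffAt_norm ℝ hw0)).contDiffWithinAt
  -- `Φ₂ ∘ val ∘ jN⁻¹` on the range of the neck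
  have hG : ContMDiffOn 𝓘(ℝ, E) 𝓘(ℝ, E) ∞
      (fun p : P => D.Φ₂ ((D.jNH.symm p : ↥(puncture D.i₂)) : N)) (range D.neck) := by
    have h1 : ContMDiffOn 𝓘(ℝ, E) 𝓘(ℝ, E) ∞ (fun p : P => ((D.jNH.symm p : ↥(puncture D.i₂)) : N))
        (range D.neck) :=
      (contMDiff_subtype_val.comp_contMDiffOn D.contMDiffOn_jNH_symm).mono D.range_neck_subset
    refine D.contMDiffOn_Φ₂.comp h1 ?_
    rintro _ ⟨⟨θ, τ⟩, rfl⟩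
    simp only [mem_preimage, neck_apply, jNH_symm_jN]
    exact D.i₂_mem_source _
  refine (hF.comp hG ?_)
  rintro _ ⟨⟨θ, τ⟩, rfl⟩
  simp only [mem_preimage, neck_apply, jNH_symm_jN, Φ₂_i₂, mem_inter_iff, mem_compl_iff,
    mem_singleton_iff, mem_ball_zero_iff, norm_tubeProfile_smul]
  exact ⟨smul_ne_zero (tubeProfile_pos τ).ne' (ne_zero_of_mem_unit_sphere θ), tubeProfile_lt_one τ⟩

/-- The neck as an open partial homeomorphism `Sⁿ × ℝ ≅ range ψ`. [folklore] -/
def neckPH : OpenPartialHomeomorph (sphere (0 : E) 1 × ℝ) P where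
  toFun := D.neck
  invFun := D.neckInv
  source := univ
  target := range D.neck
  map_source' q _ := mem_range_self q
  map_target' _ _ := mem_univ _
  left_inv' q _ := D.neckInv_neck q
  right_inv' := by rintro _ ⟨q, rfl⟩; rw [D.neckInv_neck]
  open_source := isOpen_univ
  open_target := D.isOpen_range_neck
  continuousOn_toFun := D.continuous_neck.continuousOn
  continuousOn_invFun := D.contMDiffOn_neckInv.continuousOn

/-- **The neck is a smooth embedding.** [folklore] -/
theorem isSmoothEmbedding_neck [IsManifold 𝓘(ℝ, E) ∞ P] :
    Manifold.IsSmoothEmbedding ((𝓡 n).prod 𝓘(ℝ, ℝ)) 𝓘(ℝ, E) ∞ D.neck := by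
  haveI : FiniteDimensional ℝ E := .of_fact_finrank_eq_succ (K := ℝ) (V := E) n
  have hdim : finrank ℝ (EuclideanSpace ℝ (Fin n) × ℝ) = finrank ℝ E := by
    rw [Module.finrank_prod, finrank_euclideanSpace_fin, Module.finrank_self]
    exact (Fact.out : finrank ℝ E = n + 1).symm
  exact isSmoothEmbedding_of_openPartialHomeomorph (I := (𝓡 n).prod 𝓘(ℝ, ℝ)) (J := 𝓘(ℝ, E))
    D.neckPH rfl D.contMDiff_neck.contMDiffOn D.contMDiffOn_neckInv
    (ContinuousLinearEquiv.ofFinrankEq hdim)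

/-! #### The two sides of the neck -/

/-- The far piece `N ∖ i₂(B̄(0, 1/2))` of the second summand. [folklore] -/
def UN : TopologicalSpace.Opens N :=
  ⟨(D.i₂ '' closedBall 0 (1 / 2))ᶜ, (D.isClosed_image_i₂_closedBall _).isOpen_compl⟩

/-- Membership in the far piece. [folklore] -/
theorem mem_UN {x : N} : x ∈ D.UN ↔ x ∉ D.i₂ '' closedBall 0 (1 / 2) := Iff.rfl

/-- The far piece, inside the punctured second summand. [folklore] -/
def UN' : TopologicalSpace.Opens ↥(puncture D.i₂) :=
  ⟨{b | (b : N) ∈ D.UN}, D.UN.2.preimage continuous_subtype_val⟩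

/-- Membership in the far piece of the punctured summand. [folklore] -/
theorem mem_UN' {b : ↥(puncture D.i₂)} : b ∈ D.UN' ↔ (b : N) ∉ D.i₂ '' closedBall 0 (1 / 2) := Iff.rfl

/-- **The side of the neck in the second summand**, `jN (N ∖ i₂(B̄(0, 1/2)))`. [folklore] -/
def sideN : TopologicalSpace.Opens P :=
  ⟨D.jN '' (D.UN' : Set ↥(puncture D.i₂)), D.isOpenEmbedding_jN.isOpenMap _ D.UN'.2⟩

/-- Membership in the side. [folklore] -/
theorem mem_sideN {p : P} :
    p ∈ D.sideN ↔ ∃ b : ↥(puncture D.i₂), (b : N) ∉ D.i₂ '' closedBall 0 (1 / 2) ∧ D.jN b = p :=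
  Iff.rfl

/-- `jN b` lies in the side iff `b` lies off `i₂(B̄(0, 1/2))`. [folklore] -/
theorem jN_mem_sideN_iff {b : ↥(puncture D.i₂)} :
    D.jN b ∈ D.sideN ↔ (b : N) ∉ D.i₂ '' closedBall 0 (1 / 2) := by
  rw [mem_sideN]
  constructor
  · rintro ⟨b', hb', h⟩
    rwa [D.injective_jN h] at hb'
  · exact fun h => ⟨b, h, rfl⟩

/-- `i₂ y ∉ i₂(B̄(0, r)) ↔ r < ‖y‖`. [folklore] -/
theorem i₂_not_mem_image_closedBall {y : E} {r : ℝ} :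
    D.i₂ y ∉ D.i₂ '' closedBall 0 r ↔ r < ‖y‖ := by
  rw [D.injective_i₂.mem_set_image, mem_closedBall_zero_iff, not_le]

/-- **A neck point lies in the side iff its height is positive.** [folklore] -/
theorem neck_mem_sideN_iff {θ : sphere (0 : E) 1} {τ : ℝ} : D.neck (θ, τ) ∈ D.sideN ↔ 0 < τ := by
  rw [neck_apply, jN_mem_sideN_iff]
  show D.i₂ _ ∉ _ ↔ _
  rw [i₂_not_mem_image_closedBall, norm_tubeProfile_smul, half_lt_tubeProfile_iff]

/-- The middle sphere misses the side. [folklore] -/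
theorem neck_zero_not_mem_sideN (θ : sphere (0 : E) 1) : D.neck (θ, 0) ∉ D.sideN := by
  rw [neck_mem_sideN_iff]; exact lt_irrefl 0

/-- The middle sphere of the neck is that of the swapped neck. [folklore] -/
theorem neck_zero_eq_swap (θ : sphere (0 : E) 1) : D.neck (θ, 0) = D.swap.neck (θ, 0) := by
  have h := D.neck_neg θ 0
  rwa [neg_zero] at h

/-- The middle sphere misses the other side. [folklore] -/
theorem neck_zero_not_mem_swap_sideN (θ : sphere (0 : E) 1) : D.neck (θ, 0) ∉ D.swap.sideN := by
  rw [neck_zero_eq_swap]; exact D.swap.neck_zero_not_mem_sideN θ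

/-- **Trichotomy**: a point of the punctured second summand lies in the side, on the middle
sphere, or in the other side (according as its preimage under `i₂` has norm `> 1/2`, `= 1/2` or
`< 1/2`, the last by Kervaire–Milnor's relation). [cite: KervaireMilnor1963, §2] -/
theorem jN_mem_cases (b : ↥(puncture D.i₂)) :
    D.jN b ∈ D.sideN ∨ (∃ θ : sphere (0 : E) 1, D.neck (θ, 0) = D.jN b) ∨ D.jN b ∈ D.swap.sideN := by
  by_cases hfar : (b : N) ∉ D.i₂ '' closedBall 0 (1 / 2)
  · exact Or.inl (D.jN_mem_sideN_iff.2 hfar)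
  rw [not_not] at hfar
  obtain ⟨w, hw, hbw⟩ := hfar
  have hw0 : w ≠ 0 := fun h => (mem_puncture.1 b.2) (by rw [← hbw, h])
  rw [mem_closedBall_zero_iff] at hw
  set θ := unitDir (unitSpherePoint n) w with hθ
  have hwθ : ‖w‖ • (θ : E) = w := norm_smul_coe_unitDir _ hw0
  rcases hw.lt_or_eq with hlt | heq
  · right; right
    have hwpos : 0 < ‖w‖ := norm_pos_iff.2 hw0
    have ht : (1 - ‖w‖) ∈ Ioo (0 : ℝ) 1 := ⟨by linarith, by linarith⟩
    have ha : D.i₁ ((1 - ‖w‖) • (θ : E)) ∈ puncture D.i₁ :=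
      D.swap.i₂_mem_puncture (smul_ne_zero ht.1.ne' (ne_zero_of_mem_unit_sphere θ))
    have hrel : D.jM ⟨D.i₁ ((1 - ‖w‖) • (θ : E)), ha⟩ = D.jN b := by
      rw [D.rel]
      refine ⟨θ, 1 - ‖w‖, norm_eq_of_mem_sphere θ, ht, rfl, ?_⟩
      show (b : N) = D.i₂ ((1 - (1 - ‖w‖)) • (θ : E))
      rw [sub_sub_cancel, hwθ, hbw]
    rw [← hrel]
    refine D.swap.jN_mem_sideN_iff.2 (D.swap.i₂_not_mem_image_closedBall.2 ?_)
    rw [norm_smul, norm_eq_of_mem_sphere, mul_one, Real.norm_of_nonneg ht.1.le]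
    linarith
  · right; left
    refine ⟨θ, ?_⟩
    rw [neck_apply]
    congr 1
    apply Subtype.ext
    show D.i₂ (tubeProfile 0 • (θ : E)) = b
    rw [tubeProfile_zero, ← heq, hwθ, hbw]

/-- **The two sides are disjoint** (a common point `jM (i₁ (t • u)) = jN (i₂ ((1 - t) • u))` would
have `t > 1/2` and `1 - t > 1/2`). [cite: KervaireMilnor1963, §2] -/
theorem disjoint_sideN_swap : Disjoint (D.sideN : Set P) (D.swap.sideN : Set P) := by
  rw [Set.disjoint_left]
  rintro p hpN hpM
  obtain ⟨b, hb, rfl⟩ := D.mem_sideN.1 hpN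
  obtain ⟨a, ha, hab⟩ := D.swap.mem_sideN.1 hpM
  obtain ⟨u, t, hu, ht, hau, hbu⟩ := (D.rel a b).1 hab
  rw [hbu] at hb
  rw [hau] at ha
  have hb' : (1 / 2 : ℝ) < ‖(1 - t) • u‖ := D.i₂_not_mem_image_closedBall.1 hb
  have ha' : (1 / 2 : ℝ) < ‖t • u‖ := D.swap.i₂_not_mem_image_closedBall.1 ha
  rw [norm_smul, hu, mul_one, Real.norm_of_nonneg (by linarith [ht.2] : (0 : ℝ) ≤ 1 - t)] at hb'
  rw [norm_smul, hu, mul_one, Real.norm_of_nonneg ht.1.le] at ha'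
  linarith

/-- **The sides and the middle sphere cover `P`.** [cite: KervaireMilnor1963, §2] -/
theorem exists_neck_eq_of_not_mem {p : P} (h₁ : p ∉ D.sideN) (h₂ : p ∉ D.swap.sideN) :
    ∃ θ : sphere (0 : E) 1, D.neck (θ, 0) = p := by
  have hp : p ∈ range D.jM ∪ range D.jN := D.cover.symm ▸ mem_univ p
  rcases hp with ⟨a, rfl⟩ | ⟨b, rfl⟩
  · rcases D.swap.jN_mem_cases a with h | ⟨θ, hθ⟩ | h
    · exact absurd h h₂
    · exact ⟨θ, by rw [neck_zero_eq_swap]; exact hθ⟩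
    · exact absurd h h₁
  · rcases D.jN_mem_cases b with h | ⟨θ, hθ⟩ | h
    · exact absurd h h₁
    · exact ⟨θ, hθ⟩
    · exact absurd h h₂

/-- The complement of the side together with the middle sphere is the other side. [folklore] -/
theorem compl_sideN_union :
    ((D.sideN : Set P) ∪ D.neck '' (univ ×ˢ {0}))ᶜ = (D.swap.sideN : Set P) := by
  ext p
  constructor
  · intro hp
    rw [mem_compl_iff, mem_union, not_or] at hp
    by_contra h
    obtain ⟨θ, hθ⟩ := D.exists_neck_eq_of_not_mem hp.1 h
    exact hp.2 ⟨(θ, 0), ⟨mem_univ _, rfl⟩, hθ⟩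
  · intro hp
    rw [mem_compl_iff, mem_union, not_or]
    refine ⟨fun h => Set.disjoint_left.1 D.disjoint_sideN_swap h hp, ?_⟩
    rintro ⟨⟨θ, t⟩, ⟨-, ht⟩, rfl⟩
    rw [mem_singleton_iff] at ht
    subst ht
    exact D.neck_zero_not_mem_swap_sideN θ hp

/-- The side together with the middle sphere is closed. [folklore] -/
theorem isClosed_sideN_union : IsClosed ((D.sideN : Set P) ∪ D.neck '' (univ ×ˢ {0})) := by
  rw [← isOpen_compl_iff, compl_sideN_union]; exact D.swap.sideN.2

/-- **The side of the neck in the second summand, as cap data** (`NeckCapping.lean`). [folklore] -/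
def capN [IsManifold 𝓘(ℝ, E) ∞ P] : NeckCapData n D.neck where
  isSmoothEmbedding := D.isSmoothEmbedding_neck
  isOpen_range := D.isOpen_range_neck
  side := D.sideN
  isClosed_side_union := D.isClosed_sideN_union
  image_Ioi_subset := by
    rintro _ ⟨⟨θ, t⟩, ⟨-, ht⟩, rfl⟩
    exact D.neck_mem_sideN_iff.2 ht
  not_mem_side θ t ht h := not_lt.2 ht (D.neck_mem_sideN_iff.1 h)

/-- The side of `capN` is `sideN`. [folklore] -/
@[simp] theorem capN_side [IsManifold 𝓘(ℝ, E) ∞ P] : D.capN.side = D.sideN := rfl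

/-- **The side of the flipped neck in the first summand, as cap data**: the cap data of the
swapped gluing data, transported along `neck_flip_eq`. [folklore] -/
def capM [IsManifold 𝓘(ℝ, E) ∞ P] :
    NeckCapData n (fun q : sphere (0 : E) 1 × ℝ => D.neck (q.1, -q.2)) where
  isSmoothEmbedding := by rw [D.neck_flip_eq]; exact D.swap.isSmoothEmbedding_neck
  isOpen_range := by rw [D.neck_flip_eq]; exact D.swap.isOpen_range_neck
  side := D.swap.sideN
  isClosed_side_union := by rw [D.neck_flip_eq]; exact D.swap.isClosed_sideN_union
  image_Ioi_subset := by rw [D.neck_flip_eq]; exact D.swap.capN.image_Ioi_subset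
  not_mem_side θ t ht := by
    show D.neck (θ, -t) ∉ D.swap.sideN
    rw [D.neck_neg]; exact D.swap.capN.not_mem_side θ t ht

/-- The side of `capM` is the side of the swapped data. [folklore] -/
@[simp] theorem capM_side [IsManifold 𝓘(ℝ, E) ∞ P] : D.capM.side = D.swap.sideN := rfl

/-! #### The squeeze `N ∖ i₂(B̄(0, 1/2)) ≅ N ∖ {i₂ 0}` -/

/-- `Φ₂ x ≠ 0` for `x ≠ i₂ 0` in the source. [folklore] -/
theorem Φ₂_ne_zero {x : N} (hx : x ∈ D.Φ₂.source) (hx0 : x ≠ D.i₂ 0) : D.Φ₂ x ≠ 0 := fun h =>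
  hx0 (by rw [← D.i₂_Φ₂ hx, h])

/-- `1/2 < ‖Φ₂ x‖` for `x` in the source and off `i₂(B̄(0, 1/2))`. [folklore] -/
theorem half_lt_norm_Φ₂ {x : N} (hx : x ∈ D.Φ₂.source) (hxU : x ∉ D.i₂ '' closedBall 0 (1 / 2)) :
    1 / 2 < ‖D.Φ₂ x‖ := by
  by_contra h
  exact hxU ⟨D.Φ₂ x, by simpa using not_lt.mp h, D.i₂_Φ₂ hx⟩

/-- A point off `i₂(B̄(0, 1/2))` is not the centre `i₂ 0`. [folklore] -/
theorem mem_puncture_of_mem_UN {x : N} (hx : x ∈ D.UN) : x ∈ puncture D.i₂ := by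
  rw [mem_puncture]
  rintro rfl
  exact hx ⟨0, mem_closedBall_self (by norm_num), rfl⟩

/-- The transported squeeze maps the far piece into the punctured summand. [folklore] -/
theorem chartTransport_squeeze_mem (x : ↥D.UN) :
    chartTransport D.Φ₂ squeeze (x : N) ∈ puncture D.i₂ := by
  rw [mem_puncture]
  by_cases hx : (x : N) ∈ D.Φ₂.source
  · rw [chartTransport_of_mem _ hx]
    intro h
    exact squeeze_ne_zero (D.half_lt_norm_Φ₂ hx x.2) (D.injective_i₂ h)
  · rw [chartTransport_of_not_mem _ hx]
    intro h
    exact hx (h ▸ D.i₂_mem_source 0)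

/-- The transported inverse squeeze maps the punctured summand into the far piece. [folklore] -/
theorem chartTransport_squeezeInv_mem (a : ↥(puncture D.i₂)) :
    chartTransport D.Φ₂ squeezeInv (a : N) ∈ D.UN := by
  rw [mem_UN]
  by_cases ha : (a : N) ∈ D.Φ₂.source
  · rw [chartTransport_of_mem _ ha]
    exact D.i₂_not_mem_image_closedBall.2 (half_lt_norm_squeezeInv (D.Φ₂_ne_zero ha a.2))
  · rw [chartTransport_of_not_mem _ ha]
    rintro ⟨z, -, hz⟩
    exact ha (hz ▸ D.i₂_mem_source z)

/-- The transported squeeze is smooth on the far piece. [folklore] -/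
theorem contMDiffOn_chartTransport_squeeze :
    ContMDiffOn 𝓘(ℝ, E) 𝓘(ℝ, E) ∞ (chartTransport D.Φ₂ squeeze) (D.UN : Set N) := by
  haveI : FiniteDimensional ℝ E := .of_fact_finrank_eq_succ (K := ℝ) (V := E) n
  refine (contMDiffOn_chartTransport (φ := D.Φ₂) D.contMDiffOn_Φ₂ D.contMDiff_symm₂ D.target₂
    isOpen_half_lt_norm (contMDiffOn_iff_contDiffOn.mpr contDiffOn_squeeze) (R := 7 / 9)
    (fun y hy => squeeze_eq_self hy)).mono fun x hx hxs => ?_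
  exact D.half_lt_norm_Φ₂ hxs hx

/-- The transported inverse squeeze is smooth on the punctured summand. [folklore] -/
theorem contMDiffOn_chartTransport_squeezeInv :
    ContMDiffOn 𝓘(ℝ, E) 𝓘(ℝ, E) ∞ (chartTransport D.Φ₂ squeezeInv) (puncture D.i₂ : Set N) := by
  haveI : FiniteDimensional ℝ E := .of_fact_finrank_eq_succ (K := ℝ) (V := E) n
  refine (contMDiffOn_chartTransport (φ := D.Φ₂) D.contMDiffOn_Φ₂ D.contMDiff_symm₂ D.target₂
    isOpen_compl_singleton (contMDiffOn_iff_contDiffOn.mpr contDiffOn_squeezeInv) (R := 7 / 9)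
    (fun y hy => squeezeInv_eq_self hy)).mono fun x hx hxs => ?_
  exact D.Φ₂_ne_zero hxs hx

/-- **The squeeze** `N ∖ i₂(B̄(0, 1/2)) ≅ N ∖ {i₂ 0}`: the radial squeeze transported along `Φ₂`
(`Φ₂⁻¹ ∘ squeeze ∘ Φ₂` on the disc, the identity elsewhere). [folklore] -/
def Sq [IsManifold 𝓘(ℝ, E) ∞ N] : ↥D.UN ≃ₘ⟮𝓘(ℝ, E), 𝓘(ℝ, E)⟯ ↥(puncture D.i₂) where
  toFun x := ⟨chartTransport D.Φ₂ squeeze x, D.chartTransport_squeeze_mem x⟩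
  invFun a := ⟨chartTransport D.Φ₂ squeezeInv a, D.chartTransport_squeezeInv_mem a⟩
  left_inv x := by
    apply Subtype.ext
    show chartTransport D.Φ₂ squeezeInv (chartTransport D.Φ₂ squeeze x) = x
    by_cases hx : (x : N) ∈ D.Φ₂.source
    · rw [chartTransport_of_mem _ hx, chartTransport_symm_apply D.target₂,
        squeezeInv_squeeze (D.half_lt_norm_Φ₂ hx x.2), D.Φ₂.left_inv hx]
    · rw [chartTransport_of_not_mem _ hx, chartTransport_of_not_mem _ hx]
  right_inv a := by
    apply Subtype.ext
    show chartTransport D.Φ₂ squeeze (chartTransport D.Φ₂ squeezeInv a) = a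
    by_cases ha : (a : N) ∈ D.Φ₂.source
    · rw [chartTransport_of_mem _ ha, chartTransport_symm_apply D.target₂,
        squeeze_squeezeInv (D.Φ₂_ne_zero ha a.2), D.Φ₂.left_inv ha]
    · rw [chartTransport_of_not_mem _ ha, chartTransport_of_not_mem _ ha]
  contMDiff_toFun := by
    refine (ContMDiff.subtypeVal_comp_iff _ _).mp ?_
    exact D.contMDiffOn_chartTransport_squeeze.comp_contMDiff contMDiff_subtype_val fun x => x.2
  contMDiff_invFun := by
    refine (ContMDiff.subtypeVal_comp_iff _ _).mp ?_
    exact D.contMDiffOn_chartTransport_squeezeInv.comp_contMDiff contMDiff_subtype_val fun a => a.2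

/-- The squeeze on the disc: `Sq (i₂ w) = i₂ (squeeze w)`. [folklore] -/
theorem coe_Sq_mk [IsManifold 𝓘(ℝ, E) ∞ N] {w : E} (hw : D.i₂ w ∈ D.UN) :
    ((D.Sq ⟨D.i₂ w, hw⟩ : ↥(puncture D.i₂)) : N) = D.i₂ (squeeze w) :=
  chartTransport_symm_apply D.target₂ squeeze w

/-- A point of the far piece in the source of `Φ₂` is `i₂ w` with `‖w‖ > 1/2`. [folklore] -/
theorem coe_Sq_of_mem [IsManifold 𝓘(ℝ, E) ∞ N] {x : ↥D.UN} (hx : (x : N) ∈ D.Φ₂.source) :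
    ((D.Sq x : ↥(puncture D.i₂)) : N) = D.i₂ (squeeze (D.Φ₂ x)) :=
  chartTransport_of_mem _ hx

/-- Off the source of `Φ₂` the squeeze is the identity. [folklore] -/
theorem coe_Sq_of_not_mem [IsManifold 𝓘(ℝ, E) ∞ N] {x : ↥D.UN} (hx : (x : N) ∉ D.Φ₂.source) :
    ((D.Sq x : ↥(puncture D.i₂)) : N) = x :=
  chartTransport_of_not_mem _ hx

/-! #### The second summand is the open gluing of the side and a disc along the polar relation -/

/-- The second disc is a smooth embedding. [folklore] -/
theorem isSmoothEmbedding_i₂ [IsManifold 𝓘(ℝ, E) ∞ N] :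
    Manifold.IsSmoothEmbedding 𝓘(ℝ, E) 𝓘(ℝ, E) ∞ D.i₂ :=
  isSmoothEmbedding_of_openPartialHomeomorph (I := 𝓘(ℝ, E)) (J := 𝓘(ℝ, E)) (n := ∞) D.Φ₂.symm
    (by rw [D.Φ₂.symm_source, D.target₂]) D.contMDiff_symm₂.contMDiffOn
    (by rw [D.Φ₂.symm_target, D.Φ₂.symm_symm]; exact D.contMDiffOn_Φ₂)
    (ContinuousLinearEquiv.refl ℝ _)

/-- **The cap of the presentation**: `capMap = i₂ ∘ ballContraction : E → N`. [folklore] -/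
def capMap : E → N := D.i₂ ∘ ballContraction

/-- Unfolding the cap. [folklore] -/
theorem capMap_apply (x : E) : D.capMap x = D.i₂ (ballContraction x) := rfl

/-- The cap is a smooth embedding. [folklore] -/
theorem isSmoothEmbedding_capMap [IsManifold 𝓘(ℝ, E) ∞ N] :
    Manifold.IsSmoothEmbedding 𝓘(ℝ, E) 𝓘(ℝ, E) ∞ D.capMap := by
  have h := D.isSmoothEmbedding_i₂.comp_openPartialHomeomorph
    (ballContractionPartialHomeomorph : OpenPartialHomeomorph E E) rfl
    (contMDiffOn_iff_contDiffOn.2 contDiff_ballContraction.contDiffOn)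
    (contMDiffOn_iff_contDiffOn.2 contDiffOn_ballContractionInv)
  exact h

/-- The range of the cap is the open unit disc `i₂ (B(0, 1))`. [folklore] -/
theorem range_capMap : range D.capMap = D.i₂ '' ball 0 1 := by
  apply Subset.antisymm
  · rintro _ ⟨x, rfl⟩
    exact ⟨ballContraction x, by simpa using norm_ballContraction_lt_one x, rfl⟩
  · rintro _ ⟨y, hy, rfl⟩
    rw [mem_ball_zero_iff] at hy
    exact ⟨ballContractionInv y, by rw [capMap_apply, ballContraction_ballContractionInv hy]⟩

/-- The range of the cap is open. [folklore] -/
theorem isOpen_range_capMap : IsOpen (range D.capMap) := by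
  rw [range_capMap]; exact D.isOpen_image_i₂ isOpen_ball

section Presentation

variable [IsManifold 𝓘(ℝ, E) ∞ N] [IsManifold 𝓘(ℝ, E) ∞ P]
  {ψ' : sphere (0 : E) 1 × ℝ → P} (C : NeckCapData n ψ')
  (hψ : ∀ (θ : sphere (0 : E) 1) (t : ℝ), ψ' (θ, t) = D.neck (θ, t))
  (hC : (C.side : Set P) = D.sideN)

omit [IsManifold 𝓘(ℝ, E) ∞ N] [IsManifold 𝓘(ℝ, E) ∞ P] in
include hC in
/-- Membership in the side of `C` is membership in `sideN`. [folklore] -/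
theorem mem_Cside_iff {p : P} : p ∈ C.side ↔ p ∈ D.sideN := by
  show p ∈ (C.side : Set P) ↔ _
  rw [hC]
  rfl

/-- **The side is the far piece**: `jN` restricts to a diffeomorphism `N ∖ i₂(B̄(0, 1/2)) ≅ A`.
[folklore] -/
def sideEquiv : ↥D.UN ≃ₘ⟮𝓘(ℝ, E), 𝓘(ℝ, E)⟯ ↥C.side where
  toFun x := ⟨D.jN ⟨x, D.mem_puncture_of_mem_UN x.2⟩,
    (D.mem_Cside_iff C hC).2 (D.jN_mem_sideN_iff.2 x.2)⟩
  invFun a := ⟨(D.jNH.symm a : ↥(puncture D.i₂)), by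
    obtain ⟨b, hb, hba⟩ := D.mem_sideN.1 ((D.mem_Cside_iff C hC).1 a.2)
    rw [← hba, jNH_symm_jN]
    exact hb⟩
  left_inv x := by
    apply Subtype.ext
    show ((D.jNH.symm (D.jN ⟨x, _⟩) : ↥(puncture D.i₂)) : N) = x
    rw [jNH_symm_jN]
  right_inv a := by
    apply Subtype.ext
    show D.jN ⟨(D.jNH.symm a : ↥(puncture D.i₂)), _⟩ = (a : P)
    rw [Subtype.coe_eta]
    obtain ⟨b, -, hba⟩ := D.mem_sideN.1 ((D.mem_Cside_iff C hC).1 a.2)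
    exact D.jN_jNH_symm ⟨b, hba⟩
  contMDiff_toFun := by
    refine (ContMDiff.subtypeVal_comp_iff _ _).mp ?_
    have h1 : ContMDiff 𝓘(ℝ, E) 𝓘(ℝ, E) ∞
        (fun x : ↥D.UN => (⟨(x : N), D.mem_puncture_of_mem_UN x.2⟩ : ↥(puncture D.i₂))) :=
      (ContMDiff.subtypeVal_comp_iff _ _).mp contMDiff_subtype_val
    exact D.isSmoothEmbedding_jN.contMDiff.comp h1
  contMDiff_invFun := by
    refine (ContMDiff.subtypeVal_comp_iff _ _).mp ?_
    have h1 : ContMDiffOn 𝓘(ℝ, E) 𝓘(ℝ, E) ∞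
        (fun p : P => ((D.jNH.symm p : ↥(puncture D.i₂)) : N)) (range D.jN) :=
      contMDiff_subtype_val.comp_contMDiffOn D.contMDiffOn_jNH_symm
    refine h1.comp_contMDiff contMDiff_subtype_val fun a => ?_
    obtain ⟨b, -, hba⟩ := D.mem_sideN.1 ((D.mem_Cside_iff C hC).1 a.2)
    exact ⟨b, hba⟩

omit [IsManifold 𝓘(ℝ, E) ∞ N] [IsManifold 𝓘(ℝ, E) ∞ P] in
/-- `sideEquiv` acts as `jN`. [folklore] -/
theorem coe_sideEquiv (x : ↥D.UN) :
    ((D.sideEquiv C hC x : ↥C.side) : P) = D.jN ⟨x, D.mem_puncture_of_mem_UN x.2⟩ := rfl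

omit [IsManifold 𝓘(ℝ, E) ∞ N] [IsManifold 𝓘(ℝ, E) ∞ P] in
/-- `sideEquiv⁻¹` of a neck point `jN (i₂ w)` is `i₂ w`. [folklore] -/
theorem coe_sideEquiv_symm {w : E} (hw : D.i₂ w ∈ D.UN) (hmem : D.jN ⟨D.i₂ w, D.mem_puncture_of_mem_UN hw⟩ ∈ C.side) :
    (((D.sideEquiv C hC).symm ⟨D.jN ⟨D.i₂ w, D.mem_puncture_of_mem_UN hw⟩, hmem⟩ : ↥D.UN) : N) = D.i₂ w := by
  have h : (D.sideEquiv C hC).symm ⟨D.jN ⟨D.i₂ w, D.mem_puncture_of_mem_UN hw⟩, hmem⟩ = ⟨D.i₂ w, hw⟩ := by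
    apply (D.sideEquiv C hC).injective
    show (D.sideEquiv C hC) ((D.sideEquiv C hC).symm _) = D.sideEquiv C hC _
    rw [Diffeomorph.apply_symm_apply]
    rfl
  rw [h]

/-- **The far-piece map of the presentation**: `A ≅ N ∖ i₂(B̄(0, 1/2)) ≅ N ∖ {i₂ 0} ⊆ N`. [folklore] -/
def farMap : ↥C.side → N := fun a => ((D.Sq ((D.sideEquiv C hC).symm a) : ↥(puncture D.i₂)) : N)

omit [IsManifold 𝓘(ℝ, E) ∞ P] in
/-- The far-piece map is `val ∘ (sideEquiv⁻¹ ≫ Sq)`. [folklore] -/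
theorem farMap_eq_comp :
    D.farMap C hC = Subtype.val ∘ ⇑(((D.sideEquiv C hC).symm).trans D.Sq) := rfl

/-- The far-piece map is a smooth embedding. [folklore] -/
theorem isSmoothEmbedding_farMap : Manifold.IsSmoothEmbedding 𝓘(ℝ, E) 𝓘(ℝ, E) ∞ (D.farMap C hC) := by
  rw [D.farMap_eq_comp C hC]
  exact (Manifold.IsSmoothEmbedding.of_opens (puncture D.i₂)).comp_diffeomorph _

omit [IsManifold 𝓘(ℝ, E) ∞ P] in
/-- The range of the far-piece map is the punctured summand. [folklore] -/
theorem range_farMap : range (D.farMap C hC) = (puncture D.i₂ : Set N) := by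
  have hs : Function.Surjective
      (((D.sideEquiv C hC).symm.trans D.Sq : _ ≃ₘ⟮𝓘(ℝ, E), 𝓘(ℝ, E)⟯ _) : ↥C.side → ↥(puncture D.i₂)) :=
    ((D.sideEquiv C hC).symm.trans D.Sq).toEquiv.surjective
  rw [D.farMap_eq_comp C hC, range_comp, hs.range_eq, image_univ, Subtype.range_coe]

omit [IsManifold 𝓘(ℝ, E) ∞ P] in
/-- The range of the far-piece map is open. [folklore] -/
theorem isOpen_range_farMap : IsOpen (range (D.farMap C hC)) := by
  rw [range_farMap]; exact (puncture D.i₂).2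

omit [IsManifold 𝓘(ℝ, E) ∞ P] in
/-- The two pieces cover `N`. [folklore] -/
theorem range_farMap_union : range (D.farMap C hC) ∪ range D.capMap = univ := by
  rw [range_farMap, range_capMap]
  refine eq_univ_of_forall fun x => ?_
  by_cases hx : x = D.i₂ 0
  · exact Or.inr ⟨0, mem_ball_self one_pos, hx.symm⟩
  · exact Or.inl (mem_puncture.2 hx)

omit [IsManifold 𝓘(ℝ, E) ∞ N] [IsManifold 𝓘(ℝ, E) ∞ P] in
include hψ in
/-- The polar relation of the cap data `C`, made explicit. [folklore] -/
theorem rel_iff (a : ↥C.side) (x : E) :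
    (a ∈ C.glue.source ∧ C.glue a = x) ↔
      ∃ (θ : sphere (0 : E) 1) (t : ℝ), 0 < t ∧ D.neck (θ, t) = a ∧ x = t • (θ : E) := by
  rw [NeckCapData.mem_glue_source, NeckCapData.mem_glueP_source]
  constructor
  · rintro ⟨⟨θ, t, ht, hta⟩, hx⟩
    refine ⟨θ, t, ht, (hψ θ t) ▸ hta, ?_⟩
    rw [← hx, NeckCapData.glue_apply, ← hta, NeckCapData.glueP_apply_ψ]
  · rintro ⟨θ, t, ht, hta, rfl⟩
    rw [← hψ] at hta
    refine ⟨⟨θ, t, ht, hta⟩, ?_⟩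
    rw [NeckCapData.glue_apply, ← hta, NeckCapData.glueP_apply_ψ]

omit [IsManifold 𝓘(ℝ, E) ∞ P] in
include hψ in
/-- **The far piece and the cap meet exactly along the polar relation of the neck.** This is
where the squeeze profile enters: `squeeze (ρ t • θ) = ballContraction (t • θ)`. [folklore] -/
theorem farMap_eq_capMap_iff (a : ↥C.side) (x : E) :
    D.farMap C hC a = D.capMap x ↔ (a ∈ C.glue.source ∧ C.glue a = x) := by
  rw [D.rel_iff C hψ]
  constructor
  · intro h
    set y : ↥D.UN := (D.sideEquiv C hC).symm a with hy
    have hay : (a : P) = D.jN ⟨y, D.mem_puncture_of_mem_UN y.2⟩ := by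
      have := congrArg (fun b : ↥C.side => (b : P)) ((D.sideEquiv C hC).apply_symm_apply a)
      exact this.symm
    change ((D.Sq y : ↥(puncture D.i₂)) : N) = D.i₂ (ballContraction x) at h
    by_cases hys : (y : N) ∈ D.Φ₂.source
    · rw [D.coe_Sq_of_mem hys] at h
      have h1 : squeeze (D.Φ₂ y) = ballContraction x := D.injective_i₂ h
      have hw : 1 / 2 < ‖D.Φ₂ y‖ := D.half_lt_norm_Φ₂ hys y.2
      have hx0 : x ≠ 0 := by
        rintro rfl
        rw [ballContraction_zero] at h1
        exact squeeze_ne_zero hw h1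
      set θ := unitDir (unitSpherePoint n) x
      have hxθ : ‖x‖ • (θ : E) = x := norm_smul_coe_unitDir _ hx0
      have hxpos : 0 < ‖x‖ := norm_pos_iff.2 hx0
      have h2 : D.Φ₂ y = tubeProfile ‖x‖ • (θ : E) := by
        have h3 : squeezeInv (squeeze (D.Φ₂ y)) = squeezeInv (squeeze (tubeProfile ‖x‖ • (θ : E))) := by
          rw [h1, squeeze_tubeProfile_smul (norm_eq_of_mem_sphere θ) hxpos, hxθ]
        rwa [squeezeInv_squeeze hw, squeezeInv_squeeze] at h3
        rw [norm_tubeProfile_smul]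
        exact half_lt_tubeProfile_iff.2 hxpos
      refine ⟨θ, ‖x‖, hxpos, ?_, hxθ.symm⟩
      rw [hay, neck_apply]
      congr 1
      apply Subtype.ext
      show D.i₂ (tubeProfile ‖x‖ • (θ : E)) = y
      rw [← h2, D.i₂_Φ₂ hys]
    · rw [D.coe_Sq_of_not_mem hys] at h
      exact absurd (h ▸ D.i₂_mem_source _) hys
  · rintro ⟨θ, t, ht, hta, rfl⟩
    have hw : D.i₂ (tubeProfile t • (θ : E)) ∈ D.UN :=
      D.i₂_not_mem_image_closedBall.2 (by rw [norm_tubeProfile_smul]; exact half_lt_tubeProfile_iff.2 ht)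
    have hmem : D.jN ⟨D.i₂ (tubeProfile t • (θ : E)), D.mem_puncture_of_mem_UN hw⟩ ∈ C.side := by
      rw [← neck_apply, hta]; exact a.2
    have ha : a = ⟨D.jN ⟨D.i₂ (tubeProfile t • (θ : E)), D.mem_puncture_of_mem_UN hw⟩, hmem⟩ := by
      apply Subtype.ext
      rw [← hta]
      rfl
    subst ha
    show ((D.Sq ((D.sideEquiv C hC).symm _) : ↥(puncture D.i₂)) : N) = D.i₂ (ballContraction (t • (θ : E)))
    have h1 : (D.sideEquiv C hC).symm ⟨D.jN ⟨D.i₂ (tubeProfile t • (θ : E)), D.mem_puncture_of_mem_UN hw⟩, hmem⟩ = ⟨_, hw⟩ := by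
      apply (D.sideEquiv C hC).injective
      show (D.sideEquiv C hC) ((D.sideEquiv C hC).symm _) = D.sideEquiv C hC _
      rw [Diffeomorph.apply_symm_apply]
      rfl
    rw [h1, D.coe_Sq_mk, squeeze_tubeProfile_smul (norm_eq_of_mem_sphere θ) ht]

include hψ hC in
/-- **The second summand is an open gluing of the side and a disc along the polar relation of the
neck.** [cite: Kosinski1993, Ch. VI §1 (p. 90; Prop. 1.3)] -/
theorem isOpenGluing_summand :
    IsOpenGluing 𝓘(ℝ, E) 𝓘(ℝ, E) 𝓘(ℝ, E) (A := ↥C.side) (B := E) (P := N)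
      (fun a x => a ∈ C.glue.source ∧ C.glue a = x) :=
  ⟨D.farMap C hC, D.capMap, D.isSmoothEmbedding_farMap C hC, D.isOpen_range_farMap C hC,
    D.isSmoothEmbedding_capMap, D.isOpen_range_capMap, D.range_farMap_union C hC,
    D.farMap_eq_capMap_iff C hψ hC⟩

include hψ hC in
/-- **The capped side is diffeomorphic to the summand** (uniqueness of open gluings,
`IsOpenGluing.nonempty_diffeomorph`, Kosinski VI §1). [cite: Kosinski1993, Ch. VI §1, proof of Thm (1.1)] -/
theorem nonempty_diffeomorph_capped : Nonempty (N ≃ₘ⟮𝓘(ℝ, E), 𝓘(ℝ, E)⟯ C.Capped) :=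
  IsOpenGluing.nonempty_diffeomorph (D.isOpenGluing_summand C hψ hC)
    (C.glueData.isOpenGluing fun _ _ => Iff.rfl)

end Presentation

/-- **`N ≅` the capped side of the neck.** [cite: Kosinski1993, Ch. VI §1 (p. 90; Prop. 1.3)] -/
theorem nonempty_diffeomorph_capN [IsManifold 𝓘(ℝ, E) ∞ N] [IsManifold 𝓘(ℝ, E) ∞ P] :
    Nonempty (N ≃ₘ⟮𝓘(ℝ, E), 𝓘(ℝ, E)⟯ D.capN.Capped) :=
  D.nonempty_diffeomorph_capped D.capN (fun _ _ => rfl) rfl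

/-- **`M ≅` the capped side of the flipped neck.** [cite: Kosinski1993, Ch. VI §1 (p. 90; Prop. 1.3)] -/
theorem nonempty_diffeomorph_capM [IsManifold 𝓘(ℝ, E) ∞ M] [IsManifold 𝓘(ℝ, E) ∞ P] :
    Nonempty (M ≃ₘ⟮𝓘(ℝ, E), 𝓘(ℝ, E)⟯ D.capM.Capped) :=
  D.swap.nonempty_diffeomorph_capped D.capM (fun θ t => D.neck_neg θ t) rfl

end KMNeckData

/-! ### §5 Main result: a connected sum contains a neck whose capped sides are the summands -/

/-- Unpacking `IsConnectedSum` into gluing data in chart form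
(`exists_chart_of_isSmoothEmbedding`). [folklore] -/
theorem nonempty_kmNeckData {n : ℕ} [Fact (finrank ℝ E = n + 1)]
    [IsManifold 𝓘(ℝ, E) ∞ M] [IsManifold 𝓘(ℝ, E) ∞ N]
    (h : IsConnectedSum 𝓘(ℝ, E) 𝓘(ℝ, E) 𝓘(ℝ, E) M N P) : Nonempty (KMNeckData E M N P n) := by
  haveI : FiniteDimensional ℝ E := .of_fact_finrank_eq_succ (K := ℝ) (V := E) n
  obtain ⟨i₁, i₂, h₁, h₂, jM, jN, hjM, hjMo, hjN, hjNo, hU, hR⟩ := h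
  obtain ⟨Φ₁, ht₁, hs₁, -, hΦ₁⟩ := exists_chart_of_isSmoothEmbedding h₁
  obtain ⟨Φ₂, ht₂, hs₂, -, hΦ₂⟩ := exists_chart_of_isSmoothEmbedding h₂
  subst hs₁ hs₂
  exact ⟨{ Φ₁ := Φ₁, target₁ := ht₁, contMDiffOn_Φ₁ := hΦ₁, contMDiff_symm₁ := h₁.contMDiff,
           Φ₂ := Φ₂, target₂ := ht₂, contMDiffOn_Φ₂ := hΦ₂, contMDiff_symm₂ := h₂.contMDiff,
           jM := jM, jN := jN, isSmoothEmbedding_jM := hjM, isOpen_range_jM := hjMo,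
           isSmoothEmbedding_jN := hjN, isOpen_range_jN := hjNo, cover := hU, rel := hR }⟩

/-- **A connected sum contains a neck across which it is glued from its summands.** If the
`C^∞` manifold `P` (Hausdorff, modelled on the inner product space `E ⊇ Sⁿ` of dimension `n + 1`)
is a connected sum `M # N` in the sense of Kervaire–Milnor (`IsConnectedSum`: an open gluing of
`M ∖ {i₁ 0}` and `N ∖ {i₂ 0}` along `i₁ (t • u) ∼ i₂ ((1 - t) • u)`), then `P` contains a neck
`ψ : Sⁿ × ℝ ↪ P` — the tube `ψ (θ, τ) = jN (i₂ (ρ τ • θ)) = jM (i₁ (ρ (-τ) • θ))` of the two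
discs — with two sides `D₁`, `D₂` (`NeckCapData`, `NeckCapping.lean`) of `ψ` and of the flipped
neck, disjoint and covering `P` off the middle sphere `jN (i₂ (∂B(0, 1/2)))`, whose capped sides
(`NeckCapData.Capped`: the side with its end rounded off by a disc) are diffeomorphic to `N` and
to `M` respectively. This is the converse of `NeckCapData.isConnectedSum_capped` ("joining two
manifolds by a tube is the connected sum", Kosinski, *Differential Manifolds*, VI §1, p. 90 and
Prop. 1.3; Hamilton 1997, p. 4: surgery along the tube recovers the two summands), proved by
presenting each summand as the open gluing of the corresponding side and a disc along the polar
relation of the neck (a radial squeeze `X ∖ B̄ ≅ X ∖ pt` of the summand straightens the tube)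
and invoking uniqueness of open gluings (`IsOpenGluing.nonempty_diffeomorph`).
[cite: Kosinski1993, Ch. VI §1 (p. 90; Prop. 1.3)] [cite: KervaireMilnor1963, §2] -/
theorem exists_neck_of_isConnectedSum {n : ℕ} [Fact (finrank ℝ E = n + 1)]
    [IsManifold 𝓘(ℝ, E) ∞ M] [IsManifold 𝓘(ℝ, E) ∞ N] [IsManifold 𝓘(ℝ, E) ∞ P]
    (h : IsConnectedSum 𝓘(ℝ, E) 𝓘(ℝ, E) 𝓘(ℝ, E) M N P) :
    ∃ (ψ : sphere (0 : E) 1 × ℝ → P) (D₁ : NeckCapData n ψ)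
      (D₂ : NeckCapData n (fun q : sphere (0 : E) 1 × ℝ => ψ (q.1, -q.2))),
      Disjoint (D₁.side : Set P) D₂.side ∧
      (∀ p : P, p ∉ D₁.side → p ∉ D₂.side → ∃ θ : sphere (0 : E) 1, ψ (θ, 0) = p) ∧
      Nonempty (N ≃ₘ⟮𝓘(ℝ, E), 𝓘(ℝ, E)⟯ D₁.Capped) ∧ Nonempty (M ≃ₘ⟮𝓘(ℝ, E), 𝓘(ℝ, E)⟯ D₂.Capped) := by
  obtain ⟨D⟩ := nonempty_kmNeckData (n := n) h
  exact ⟨D.neck, D.capN, D.capM, D.disjoint_sideN_swap,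
    fun p h₁ h₂ => D.exists_neck_eq_of_not_mem h₁ h₂, D.nonempty_diffeomorph_capN,
    D.nonempty_diffeomorph_capM⟩

end KM

end Literature.Topology.FourManifolds

end
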